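import Mathlib
import Literature.MathematicalPhysics.QuantumFieldTheory.Balaban1983to89.T4FixedPointResponse
import Literature.MathematicalPhysics.QuantumFieldTheory.Balaban1983to89.T4OneStepKernel1D
import Literature.MathematicalPhysics.QuantumFieldTheory.Balaban1983to89.Beta.ElimJacobianAlgebra

/-!
# T⁴ continuum, node U1b / NE3 — the one-step correction FACTORISES THROUGH THE LAPLACIAN ("no sheets")

Cell `pub-balaban`, T⁴ fan-out, PROVER seat P1 for the spine estimate NE3 (η-rate of the minimisers), technique
= implicit-function / contraction-mapping on the variational fixed point of [Balaban1985Variational] Sect. E;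
lineage `b2b-balaban-t4-ne3-p1`, generation 2 (§§1–5) and generation 3 (§1 cov, §3b, §4c, §5b; carved row
`T4-U1b.E-NE3-OSC°`; v1.2 §4d, §5c; v1.3 §4e + docstring corrections from the outside read C-pv06g14-1).  Companion of `T4FixedPointResponse` (gen 1: Lipschitz response of the
(116)–(121) fixed point, the first-order transfer ρ_k = osc_k, the wall shape `OneStepCorrectionRate`) and of
`T4OneStepKernel1D` (gen 1: the 1D block identities, κ_L = (L² − 1)/(6L²)); one moment sum
(`sum_range_sq_sub`) is imported by name from the β sub-cell's `Beta.ElimJacobianAlgebra`.  HONEST FRAMING: finite torus T⁴, rung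
(B)+1 of the cell's ladder; NOT infinite volume, NOT a mass gap, NOT the Clay problem; this seat's node is
minimisers-only — none of the cell's conditionals (BetaPertH, (B), (B^μ)) enters anything below.  Value = kernel
lemmas over MODEL shapes + a sharper typed wall, NOT summit progress.

## What is printed and used (read on the renders; [R] = located reading, quoted «verbatim»)

* [Balaban1985Variational] p. 278 [R], the class 𝔘_k({Ω_j}, ε₀), display (2): «|U(∂p) − 1| = |(∂U)(p) − 1| <
  ε₀L^{−2j} = ε₀η²(L^jη)^{−2} for p ∈ Ω_j, j = 0, 1, …, k, |(D_U^{η*}∂U)(b)| < ε₀L^{−2j}(L^jη)^{−1} = ε₀η²(L^jη)^{−3} for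
  b ∈ Ω_j, (2)» — the SECOND clause bounds the covariant divergence of the curvature, i.e. the CURRENT of U
  (the adjoint covariant derivative is printed `D_U^{η*}`; cross-read C-adv9-81 R1).
* p. 279 [R], Theorem 1: the minimal orbit lies in the space (8) «𝔘_k({Ω_j}, B₃ε₁) ∩ 𝔅_k(𝔅_k, V)»; and the first
  two clauses of (9) «|A| < B₃Mε₁(L^jη)^{−1}, |∇^ηA| < B₃Mε₁(L^jη)^{−2}» (tree: `B11Thm1.Ineq9`, first two conjuncts).
  The third clause of (9) (the ‖·‖_{1,β} seminorm, β ≤ β₀) is NOT used here (cf. the b11 lineage's located gap on the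
  endpoint β₀ = 1, GAPS G-B11-F3a).
* p. 294–296: the space (115) (p. 294; cross-read C-adv9-81 R2), the map (116), the bound (117) «By Theorem 3.13 of
  [5] the norm … can be estimated by …» and Proposition 6 — consumed only through the tree shapes of `B11Prop6Scheme` / `T4R1Response` /
  `T4FixedPointResponse` (by name), exactly as in generation 1.

## The observation of this generation (MODEL mathematics; the dictionary is stated, nothing is asserted)

Gen 1 reduced NE3's local rate to ONE estimate, OSC: the (115)-norm of the propagated one-step correction current,
osc_k(V) = ‖𝔊(W)𝔓J^δ(W)‖_(115), W = U_k(V), decays like ρθ^k (record `t4/T4-EST-NE3-P1.md` v1.1 §4), and split the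
missing work into OSC-sheet (face-layer sources under the unit-scale propagator 𝔊) and OSC-lin-s, OSC-lin-v (fourth-
order symbol facts).  In the LINEARISED, FLAT model all of this collapses into algebra:

* the response is X = U_k(V) − Q₁U_{k+1}(V) = 𝔊·M·W with M := Δ^eff_(1) − Δ the one-step correction operator
  (effective one-step Laplacian minus the bare one) acting on the background W;
* CONSTRAINED GREEN IDENTITY (§1): 𝔊 := G_a − G_aEG_a with G_a = (Δ + aQ*Q)⁻¹, E = Q*(QG_aQ*)⁻¹Q satisfies
  𝔊Δ = 1 − Π, Π := G_aE = "linear minimiser ∘ average" (`constrainedGreen_mul_laplacian`, a ring identity from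
  G_a(Δ + K) = 1 and EG_aK = K, K = aQ*Q);
* FACTORISATION (§1): in one dimension with block means the Schur complement is S = QG_fQ* = G_c − κ_L(1 − P) on
  mean-zero functions EXACTLY (§5, `blockAvg_green`: the block average of the fine Green function is the coarse Green
  function shifted by the constant −κ_L off the zero mode), hence Δ^eff = Δ(1 − κ_LΔ)⁻¹ (`schur_mul_effLaplacian`)
  and M = κ_LΔ²(1 − κ_LΔ)⁻¹ = Δ·n·Δ, n := κ_L(1 − κ_LΔ)⁻¹ (`correction_eq_lap_mul_lap`);
* hence X = 𝔊ΔnΔW = (1 − Π)·n·J(W) with J(W) := ΔW the BARE current of the background (`propagated_correction_eq`):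
  NO propagator acts on the correction — the unit-scale operator 𝔊 has been traded for the identity minus a bounded
  projection, and what remains is the LATTICE-scale operator n applied to a printed-small quantity;
* NEUMANN (§2): ‖Δ‖_{∞→∞} = 4 in 1D and κ_L < 1/6 (`T4OneStepKernel1D.kappa_lt_one_sixth`) give
  ‖n‖_{∞→∞} ≤ κ_L/(1 − 4κ_L) =: ν_L < 1/2 (`norm_corrFactor_le`, `norm_corrFactor_le_nu`, `nu_lt_half`; symbol form
  0 ≤ M̂ ≤ ν_LΔ̂², `symbol_correction_le`);
* SIZES (§3–§4): sup|X̂| ≤ (1 + C_Π)ν_L sup|Ĵ| and, with the trivial ‖∇̂‖ ≤ 2 =: C_D and ‖∇̂Π‖ ≤ C_Π′,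
  sup|∇̂X̂| ≤ (C_D + C_Π′)ν_L sup|Ĵ| (`noSheet_norm_le`, `noSheet_grad_norm_le`); the dictionary Ĵ = η³J_phys and the
  printed current clause of (2) with ε₀ = B₃ε₁ (Theorem 1 (8)) read sup|Ĵ| < B₃ε₁η³ on the top region; the (115)
  weights (potential A = X̂/η, gradient ∇^ηA = η⁻²∇̂X̂) then give osc_k ≤ (1 + C_Π + C_D + C_Π′)·ν_L·B₃ε₁·(L⁻¹)^k,
  i.e. the gen-1 wall shape `T4FixedPointResponse.OneStepCorrectionRate dom osc ρ L⁻¹` holds IN THE MODEL with an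
  explicit ρ (`oneStepCorrectionRate_of_noSheet`) — rate θ = L⁻¹, no sheet analysis, no fourth differences of W:
  the face-layer kinks of the bare current cost exactly the one power of η that separates the two levels of (115),
  automatically.

## What this does NOT do, and the sharpened wall (records: `t4/T4-EST-NE3-P1.md` v2, GAPS G-ne3p1-6 ff.)

Nothing here is asserted about Bałaban's nonlinear, gauge-covariant objects: every operator statement above is a
hypothesis shape or an identity in an abstract (normed) ring, and the 1D identities are identities of real numbers.
OSC itself stays OPEN.  After this re-cut the missing estimate is, precisely, the LAPLACIAN-RANGE
REPRESENTATION (LRR, §4b) of the one-step correction current on the curved class-(14) background W = U_k(V):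
J^δ(W) = Δ_W Z + ζ + r with ζ ∈ Range K_W (constraint forces; 𝔊 kills them), sup|Ẑ| ≤ C_Z(1 + k log L)·B₃ε₁η³
(the size of the printed current, one logarithm admitted) and |r|_(−3) ≤ C_Rη, C_R ∝ ε₁² (propagated crudely by
the printed (117)) — then `oneStepCorrectionRate_of_lrr` gives `OneStepCorrectionRate … ((1 + log L)/L)`.  Its flat
linearised 1D instance is kernel-exact here (Z = nJ(W), ζ = r = 0, C_Z = ν_L); the covariant statement is a
routine-very-long consistency computation for the actual averaging / gauge fixing / propagators of
[Balaban1985Averaging], [Balaban1985BackgroundPropagators] — NOT PRINTED (B11 treats class-(7) data only) — plus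
the tail count (cubic and higher local gauge invariants of the one-step correction functional: currents of
lattice size ε₁²η⁵, |·|_(−3)-size ε₁²η², a power of η to spare) and the located readings
(Q), (P), (I), (E) of record v1.1 §3.  In d ≥ 2 the identities persist for translation-invariant models
(n = Δ⁻¹MΔ⁻¹ and N = Δ⁻¹M are bounded Fourier multipliers because M̂ = O(|p|⁴)), but n̂ → a₂(p)/|p|² is homogeneous
of degree 0 at p = 0 — a Calderón–Zygmund kernel — so ‖n‖_{∞→∞} on the torus of side L^k·ℓ carries one factor
C(1 + k log L) unless the quartic symbol a₂ is isotropic (it is not for block means: gen-1 toy, M̂/|p|⁴ → 0.125 on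
the axis vs 0.09375 on the diagonal, L = 2, d = 2); §4b absorbs the logarithm into the rate θ′ = (1 + log L)/L < 1,
which is all the consumers `T4EtaRateMin.LocalRate` need.  Labels: [folklore] = elementary algebra / real analysis proved below; "[model]" inside a
docstring marks the dictionary sentence; no printed bound is asserted anywhere (ABSOLUTE RULE: 0 internally-minted
facts; the manuscripts under audit are not cited for disputed steps — nothing of theirs is cited as a fact at all).

## Generation 3 (carved row `T4-U1b.E-NE3-OSC°`): the covariant shape, the wall BY NAME, the quartic symbol

* COVARIANT SHAPE (§1, §3b).  On a curved background the correction operator cannot factorise as `Δ N` alone —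
  constraint forces and curvature remainders appear; the identity that survives is
  `M = Δ N + K E′ + R_M  ⇒  𝔊 M = (1 − Π) N + 𝔊 R_M` (`propagated_correction_eq_cov`, from `𝔊Δ = 1 − Π` and
  `𝔊K = 0`), with the size consequence `‖𝔊 M W‖ ≤ (1 + C_Π)‖N W‖ + ‖𝔊 R_M W‖` (`covFactorisation_norm_le`, operators
  in `Module.End ℝ E` of a seminormed space).  [model] This is the typed form of the wall LRR-lin-cov (GAPS
  G-ne3p1-7 ≡ G-ne3p2-1 ≡ G-ne5p1-2, one statement): for Bałaban's covariant averaging, gauge fixing and propagators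
  `M_U = Δ_U N_U + K_U E′_U + R_U`, `N_U` second-moment (Calderón–Zygmund) bounded uniformly on the class (14),
  `R_U = O(F̂(U))·bounded·∇̂` — NOT PRINTED, not asserted.
* THE WALL BY NAME (§4c).  `LRRSized dom z t osc L C_Π C_D C_Z B B₀ C_R` packages the three sized clauses of §4b
  (pre-current, tail, two-level (115) bookkeeping) into ONE `Prop`; `oneStepCorrectionRate_of_lrrSized : LRRSized …
  → OneStepCorrectionRate dom osc ρ ((1 + log L)/L)` and the consumer-facing `localRate_of_lrrSized : LRRSized … →
  (reading, response, pairing) → T4EtaRateMin.LocalRate R … ((1 + log L)/L)` (through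
  `T4FixedPointResponse.localRate_of_oneStep'`).  Downstream seats cite the missing estimate as `(h : LRRSized …)`:
  one name for the (115)-currency (sup-norm) form of OSC; its energy-currency twin is
  `T4ConvexResponse.DefectDerivBound` (sibling lineage ne3-p2; the dictionary between the two currencies is
  `T4FixedPointResponse.propagated_residual_eq` ↔ `T4ConvexResponse.residual_pairing`, record `t4/T4-EST-U1b-OSC.md`).
* THE QUARTIC SYMBOL (§5b) [numerics → conjectured closed form; NOT a theorem about Bałaban's operators].  The
  LINEAR averaging of 1-forms is printed: [Balaban1984PropagatorsI] p. 18–19, blocks (1.6), contours (1.7)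
  «Γ_{y,x} = [y, (y₁, …, y_{d−1}, x_d)] ∪ … ∪ [(y₁, x₂, …, x_d), x]», and (1.8) «B_c = Σ_{x∈B(c₋)}
  L^{−(d+1)}(A(Γ_{c₋,x}) + A([x, x(c)]) + A(Γ_{x(c),c₊}))» (p. 19; equivalently, with «A(Γ) = Σ_{b⊂Γ} A_b for arbitrary
  contour Γ» ibid., the sum of A over the concatenated contour Γ_{c,x} := Γ_{c₋,x} ∪ [x, x(c)] ∪ Γ_{x(c),c₊} of
  [Balaban1985Averaging] p. 19); it is the linear term of the group-valued averaging (15) of [Balaban1985Averaging]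
  (p. 19–20: «expanding the logarithm … we get the expression (14) as a linear term», (14) = (1.8) of CMP 95).  The
  gen-3 two-engine toy (`a2_symbol_toy.py`; engine A = closed-form momentum-space symbols of (1.8) with the contours
  (1.7) and the Wilson quadratic forms (1.5) fine and coarse; engine B = exact rational constrained minimisation on
  the tori 8², 12², 4³ built by walking the contours — agreement ≤ 4.2e−15) finds for d = 2, 3, 4, L = 2, 3, 4: the
  transverse block of the one-step defect `M(P) = L⁴K_eff(P) − K_c(P)` is `O(|P|⁴)` with vanishing cubic part and
  zero gauge leakage (the SHAPE `M = Δ·N`, `N` second order, holds at the linearised level for this averaging), and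
  its quartic symbol equals, to ≤ 2·10⁻⁷ on random directions (within the Richardson error of the numerically
  extracted quartic coefficient; ≈ 1e−8 at L = 2; scalars 3.9e−10) and for both staircase orders, the explicit form
  `quarticDefectForm κ_L ξ ε = (κ_L/2)[(|ξ|⁴ + Σ_μ ξ_μ⁴)|ε|² + |ξ|²Σ_μ ξ_μ²ε_μ²]` on transverse polarisations `ε ⊥ ξ`
  (scalar block means: `quarticDefectScalar κ_L ξ = (κ_L/2)(|ξ|⁴ + Σ_μ ξ_μ⁴)`; d = 1: `κ_L|ξ|⁴`, the constant of
  `T4OneStepKernel1D`), κ_L = (L² − 1)/(6L²).  Two kernel facts about these POLYNOMIALS decide the leaf: in d = 2 the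
  form is `κ_L|ξ|⁴|ε|²` on `ε ⊥ ξ` (`quarticDefectForm_two_dim`: the 2D defect is LOCAL, `M ≃ κ_L Δ·d*d`, no
  logarithm), while in d ≥ 3 its normalised value is κ_L at (ξ, ε) = (e₁, e₂) and 3κ_L/4 at (e₁ + e₂, e₃)
  (`quarticDefectForm_anisotropic`, `quarticDefectForm_not_isotropic`): the degree-0 part of `n = MΔ⁻²` contains the
  second Riesz transforms `∂_μ²Δ⁻¹` and `Σ_μ∂_μ⁴Δ⁻²`, so for THIS averaging in d = 4 the logarithm of §4b is genuinely
  present at the linearised level, and the log-absorbed leaf `oneStepCorrectionRate_of_lrr` (θ′ = (1 + log L)/L) —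
  not the no-log §4 (θ = L⁻¹) — is the one the covariant estimate must feed.
* SHARP RATE (§4d, v1.2) [kernel arithmetic].  `(1 + k log L)L^{−k} ≤ (e^{−a}/(1 − a))·(L^{−a})^k` for every `a < 1`
  and every `L > 0` (`one_add_mul_log_mul_pow_le_rpow`, from `1 + t ≤ eᵗ`), hence `oneStepCorrectionRate_of_lrr_rpow`
  / `oneStepCorrectionRate_of_lrrSized_rpow` / `localRate_of_lrrSized_rpow`: the LRR wall gives
  `OneStepCorrectionRate … (L^{−a})` and `T4EtaRateMin.LocalRate … (L^{−a})` at ANY rate short of `L^{−1}`, the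
  logarithm costing the constant `e^{−a}/(1 − a)` only — relevant because the Bernoulli rate `(1 + log L)/L` of §4b
  (0.847, 0.6995 at L = 2, 3) is weaker than the `L^{−1/3}` benchmark (0.794, 0.693) of the sup reading (F) for
  small L, whereas `L^{−a}`, `a ∈ (1/3, 1)` fixed, beats it for every L.
* SCALAR MECHANISM (§5c, v1.2) [analysis → kernel arithmetic, formal Taylor level].  For scalar block means the
  closed form of §5b is DERIVED: `M = L²S_c − K_c`, `S_c = K(P/L)/|q̂(P/L)|² + O(P⁶)` (covers enter at `O(P⁶)`),
  `1/|q̂(P/L)|² = 1 + (κ_L/2)|P|² + O(P⁴)`, `L²K(P/L) − K_c(P) = (1/12 − 1/(12L²))ΣP_μ⁴ + O(P⁶)` and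
  `κ_L/2 = 1/12 − 1/(12L²)` (`kappa_half_eq`, `scalar_quartic_bookkeeping`, `quarticDefectScalar_eq_bookkeeping`): the
  isotropic term is the block-average symbol, the anisotropic `(κ_L/2)Σξ_μ⁴` is the two-spacing difference of the
  lattice Laplacian's quartic Taylor coefficient.  The 1-form closed form stays conjectured (toy-verified only).
* THE NODE'S SHAPE BY NAME (§4e, v1.3) [kernel bookkeeping].  `ne3Shape_of_lrrSized` / `ne3Shape_of_lrrSized_rpow`:
  the wall `LRRSized` + the gen-1 reading / response / pairing hypotheses + «the scalar reading is the sum of the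
  local readings over at most `vol` unit sites» give the node's FULL two-reading shape `T4EtaRateMin.NE3Shape R C θ`
  (`0 ≤ θ < 1`, `ActionRate`, `LocalRate`) BY NAME, at `θ = (1 + log L)/L` (`L ≥ 2`) and at `θ = L^{−a}`
  (`0 < a < 1`, `L > 1`) — so the single unprinted inequality of the lineage (clause 1 of `LRRSized`, the covariant
  linearised estimate LRR-lin-cov) is, constants aside, ALL that separates the printed inputs from the node's typed
  target in the (115) currency.  Nothing here asserts that inequality.
-/

namespace Literature.MathematicalPhysics.QuantumFieldTheory.Balaban1983to89.T4OneStepFactorisation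

open Finset
open Literature.MathematicalPhysics.QuantumFieldTheory.Balaban1983to89.T4OneStepKernel1D
  (kappa blockAvgAbs blockAvgAbs_eq sum_sum_sub_eq_zero kappa_lt_one_sixth one_eighth_le_kappa)
open Literature.MathematicalPhysics.QuantumFieldTheory.Balaban1983to89.T4FixedPointResponse
  (OneStepCorrectionRate localRate_of_oneStep')
open Literature.MathematicalPhysics.QuantumFieldTheory.Balaban1983to89.T4EtaRateMin (Readings LocalRate)
open Literature.MathematicalPhysics.QuantumFieldTheory.Balaban1983to89.Beta.ElimJacobianAlgebra
  (sum_range_sq_sub)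

/-! ## §1 Ring identities: the constrained Green operator, the effective Laplacian, the factorisation -/

section ConstrainedGreen

variable {R : Type*} [Ring R]

/-- **Constrained Green identity.** In a ring: if `Ga` is a left inverse of `D = Δ + K` and `E` reproduces `K`
through `Ga` (`E * Ga * K = K`), then the "constrained Green operator" `𝔊 := Ga − Ga E Ga` satisfies
`𝔊 Δ = 1 − Ga E`.  [model] Dictionary (flat linearised one-step / k-step problem, NOT asserted about Bałaban's
operators): `Δ` = lattice Laplacian, `K = a Q*Q` (the averaging constraint added to the quadratic form),
`Ga = (Δ + K)⁻¹`, `E = Q*(Q Ga Q*)⁻¹Q`, `Π := Ga E` = "linear minimiser ∘ average", `𝔊` = the propagator of the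
constrained linear problem; then `𝔊Δ = 1 − Π`. [folklore] -/
theorem constrainedGreen_mul_laplacian {Ga D Δ K E : R}
    (hGD : Ga * D = 1) (hD : D = Δ + K) (hE : E * Ga * K = K) :
    (Ga - Ga * E * Ga) * Δ = 1 - Ga * E := by
  subst hD
  have h1 : (Ga - Ga * E * Ga) * Δ
      = (Ga * (Δ + K) - Ga * E * (Ga * (Δ + K))) - (Ga * K - Ga * (E * Ga * K)) := by
    noncomm_ring
  rw [h1, hGD, hE, mul_one, sub_self, sub_zero]

/-- The constrained Green operator annihilates the constraint directions: `𝔊 K = 0`. [folklore] -/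
theorem constrainedGreen_mul_constraint {Ga K E : R} (hE : E * Ga * K = K) :
    (Ga - Ga * E * Ga) * K = 0 := by
  have h1 : (Ga - Ga * E * Ga) * K = Ga * K - Ga * (E * Ga * K) := by noncomm_ring
  rw [h1, hE, sub_self]

/-- `Π = Ga E` is idempotent as soon as `E Ga E = E` (which holds for `E = Q*(Q Ga Q*)⁻¹Q`). [folklore] -/
theorem minimiserProj_idem {Ga E : R} (hEE : E * Ga * E = E) :
    (Ga * E) * (Ga * E) = Ga * E := by
  have h1 : (Ga * E) * (Ga * E) = Ga * (E * Ga * E) := by noncomm_ring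
  rw [h1, hEE]

/-- And `Π` fixes the constraint directions read through `Ga`: `Π (Ga K) = Ga K`. [folklore] -/
theorem minimiserProj_mul {Ga K E : R} (hE : E * Ga * K = K) :
    (Ga * E) * (Ga * K) = Ga * K := by
  have h1 : (Ga * E) * (Ga * K) = Ga * (E * Ga * K) := by noncomm_ring
  rw [h1, hE]

/-- **No-sheet identity.** If the correction operator factorises through the Laplacian ON THE LEFT, `M = Δ N`,
then the propagated correction is `𝔊 M = (1 − Π) N`: no propagator acts on `N`. [folklore] -/
theorem propagated_correction_eq {𝔊 Δ Pm M N : R} (h𝔊Δ : 𝔊 * Δ = 1 - Pm) (hM : M = Δ * N) :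
    𝔊 * M = (1 - Pm) * N := by
  rw [hM, ← mul_assoc, h𝔊Δ]

/-- The two together. [folklore] -/
theorem propagated_correction_eq' {Ga D Δ K E M N : R}
    (hGD : Ga * D = 1) (hD : D = Δ + K) (hE : E * Ga * K = K) (hM : M = Δ * N) :
    (Ga - Ga * E * Ga) * M = (1 - Ga * E) * N :=
  propagated_correction_eq (constrainedGreen_mul_laplacian hGD hD hE) hM

/-- **Covariant left factorisation (generation 3; the typed shape of the wall LRR-lin-cov).**  If the correction
operator factorises through the Laplacian UP TO constraint forces and a remainder, `M = Δ N + K E′ + R_M`, then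
`𝔊 M = (1 − Π) N + 𝔊 R_M`: the constraint-range term is annihilated (`𝔊K = 0`) and only the remainder still
carries the propagator.  [model] Dictionary (curved class-(14) background W, Bałaban's covariant averaging /
gauge fixing / propagators; NOT PRINTED, not asserted): `Δ = Δ_W`, `K = K_W` (averaging constraint), `N = N_W`
second-moment bounded uniformly on the class, `R_M = O(F̂(W))·bounded·∇̂`. [folklore] -/
theorem propagated_correction_eq_cov {𝔊 Δ K Pm M N E' Rm : R}
    (h𝔊Δ : 𝔊 * Δ = 1 - Pm) (h𝔊K : 𝔊 * K = 0) (hM : M = Δ * N + K * E' + Rm) :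
    𝔊 * M = (1 - Pm) * N + 𝔊 * Rm := by
  rw [hM, mul_add, mul_add, ← mul_assoc, h𝔊Δ, ← mul_assoc, h𝔊K, zero_mul, add_zero]

/-- The same from the constrained-Green data of `constrainedGreen_mul_laplacian` / `_mul_constraint`. [folklore] -/
theorem propagated_correction_eq_cov' {Ga D Δ K E M N E' Rm : R}
    (hGD : Ga * D = 1) (hD : D = Δ + K) (hE : E * Ga * K = K) (hM : M = Δ * N + K * E' + Rm) :
    (Ga - Ga * E * Ga) * M = (1 - Ga * E) * N + (Ga - Ga * E * Ga) * Rm :=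
  propagated_correction_eq_cov (constrainedGreen_mul_laplacian hGD hD hE)
    (constrainedGreen_mul_constraint hE) hM

end ConstrainedGreen

section EffectiveLaplacian

variable {R : Type*} [CommRing R]

/-- **The one-step effective Laplacian (commutative symbol calculus).** If `G Δ = 1 − P` (Green operator modulo
the zero mode) and the Schur complement of the one-step problem is `S = G − κ(1 − P)`, then `S` is inverted,
modulo `P`, by `Δ^eff := Δ (1 − κΔ)⁻¹`: `S · Δ^eff = 1 − P`.  [model] Dictionary (1D block means, EXACT — §5):
`S = Q G_f Q*` on mean-zero lattice functions, `κ = κ_L = (L² − 1)/(6L²)`. [folklore] -/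
theorem schur_mul_effLaplacian {S G Δ P κ : R} (hGΔ : G * Δ = 1 - P) (hS : S = G - κ * (1 - P))
    (u : Rˣ) (hu : (u : R) = 1 - κ * Δ) :
    S * (Δ * ↑u⁻¹) = 1 - P := by
  have h1 : S * Δ = (1 - P) * ↑u := by
    rw [hu]; linear_combination Δ * hS + hGΔ
  calc S * (Δ * ↑u⁻¹) = (S * Δ) * ↑u⁻¹ := by rw [mul_assoc]
    _ = (1 - P) * (↑u * ↑u⁻¹) := by rw [h1, mul_assoc]
    _ = 1 - P := by rw [Units.mul_inv, mul_one]

/-- **The correction operator factorises through the Laplacian on both sides:**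
`M := Δ^eff − Δ = Δ (1 − κΔ)⁻¹ − Δ = Δ · (κ (1 − κΔ)⁻¹) · Δ = Δ · n · Δ`. [folklore] -/
theorem correction_eq_lap_mul_lap {Δ κ : R} (u : Rˣ) (hu : (u : R) = 1 - κ * Δ) :
    Δ * ↑u⁻¹ - Δ = Δ * (κ * ↑u⁻¹) * Δ := by
  have h1 : (1 : R) - ↑u = κ * Δ := by rw [hu]; ring
  calc Δ * ↑u⁻¹ - Δ = Δ * ↑u⁻¹ * 1 - Δ * (↑u⁻¹ * ↑u) := by rw [mul_one, Units.inv_mul, mul_one]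
    _ = Δ * ↑u⁻¹ * (1 - ↑u) := by rw [← mul_assoc, mul_sub]
    _ = Δ * ↑u⁻¹ * (κ * Δ) := by rw [h1]
    _ = Δ * (κ * ↑u⁻¹) * Δ := by ring

/-- In particular `M = Δ · N` with `N := n Δ = κ (1 − κΔ)⁻¹ Δ` — the LEFT factorisation used by
`propagated_correction_eq`. [folklore] -/
theorem correction_eq_lap_mul {Δ κ : R} (u : Rˣ) (hu : (u : R) = 1 - κ * Δ) :
    Δ * ↑u⁻¹ - Δ = Δ * (κ * ↑u⁻¹ * Δ) := by
  rw [correction_eq_lap_mul_lap u hu]; ring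

/-- `n = κ (1 − κΔ)⁻¹` is the resolvent-type series `κ Σ (κΔ)^m`: its defining relation `n (1 − κΔ) = κ`,
i.e. `n = κ + κ Δ n`-type bookkeeping, in the form `n * u = κ`. [folklore] -/
theorem corrFactor_mul_unit {Δ κ : R} (u : Rˣ) (hu : (u : R) = 1 - κ * Δ) :
    (κ * ↑u⁻¹) * ↑u = κ ∧ κ * ↑u⁻¹ = κ + κ * Δ * (κ * ↑u⁻¹) := by
  refine ⟨by rw [mul_assoc, Units.inv_mul, mul_one], ?_⟩
  have h1 : κ * Δ = 1 - ↑u := by rw [hu]; ring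
  calc κ * ↑u⁻¹ = (κ * Δ + ↑u) * (κ * ↑u⁻¹) := by rw [h1, sub_add_cancel, one_mul]
    _ = κ + κ * Δ * (κ * ↑u⁻¹) := by
        rw [add_mul]
        have : (u : R) * (κ * ↑u⁻¹) = κ := by
          rw [mul_comm, mul_assoc, Units.inv_mul, mul_one]
        rw [this, add_comm]

end EffectiveLaplacian

/-! ## §2 The Neumann bound for the correction factor `n = κ (1 − κΔ)⁻¹` -/

section Neumann

variable {A : Type*} [NormedRing A] [NormOneClass A] [HasSummableGeomSeries A]

/-- `‖(1 − x)⁻¹‖ ≤ (1 − ‖x‖)⁻¹` for `‖x‖ < 1` in a normed ring with `‖1‖ = 1` (geometric series). [folklore] -/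
theorem norm_oneSub_inv_le (x : A) (hx : ‖x‖ < 1) :
    ‖(↑(Units.oneSub x hx)⁻¹ : A)‖ ≤ (1 - ‖x‖)⁻¹ := by
  have h := tsum_geometric_le_of_norm_lt_one x hx
  rw [NormOneClass.norm_one, sub_self, zero_add] at h
  exact h

variable [NormedAlgebra ℝ A]

/-- **Neumann bound for the correction factor.** If `0 ≤ κ`, `‖Δ‖ ≤ d` and `κ d < 1`, then `κΔ` has norm `< 1`
and `n := κ (1 − κΔ)⁻¹` has `‖n‖ ≤ κ / (1 − κ d)`.  [model] Dictionary: `Δ` = the 1D lattice Laplacian acting on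
`ℓ^∞` (`d = 4`), `κ = κ_L < 1/6` (tree `T4OneStepKernel1D.kappa_lt_one_sixth`) ⇒ `‖n‖_{∞→∞} ≤ ν_L < 1/2` (§2,
`nu_lt_half`). [folklore] -/
theorem norm_corrFactor_le {κ d : ℝ} (hκ : 0 ≤ κ) (hκd : κ * d < 1) (Δ : A) (hΔ : ‖Δ‖ ≤ d) :
    ∃ h : ‖κ • Δ‖ < 1, ‖κ • (↑(Units.oneSub (κ • Δ) h)⁻¹ : A)‖ ≤ κ / (1 - κ * d) := by
  have hx : ‖κ • Δ‖ ≤ κ * d := by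
    rw [norm_smul, Real.norm_of_nonneg hκ]
    exact mul_le_mul_of_nonneg_left hΔ hκ
  have hx1 : ‖κ • Δ‖ < 1 := lt_of_le_of_lt hx hκd
  refine ⟨hx1, ?_⟩
  have hpos : 0 < 1 - κ * d := by linarith
  calc ‖κ • (↑(Units.oneSub (κ • Δ) hx1)⁻¹ : A)‖
      = κ * ‖(↑(Units.oneSub (κ • Δ) hx1)⁻¹ : A)‖ := by rw [norm_smul, Real.norm_of_nonneg hκ]
    _ ≤ κ * (1 - ‖κ • Δ‖)⁻¹ := mul_le_mul_of_nonneg_left (norm_oneSub_inv_le _ hx1) hκ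
    _ ≤ κ * (1 - κ * d)⁻¹ := by
        apply mul_le_mul_of_nonneg_left _ hκ
        exact inv_anti₀ hpos (by linarith)
    _ = κ / (1 - κ * d) := by rw [div_eq_mul_inv]

end Neumann

/-- The 1D model value of the bound: `ν_L := κ_L / (1 − 4κ_L)` (`‖Δ‖_{∞→∞} = 4` in one dimension). [folklore] -/
noncomputable def nu (L : ℕ) : ℝ := kappa L / (1 - 4 * kappa L)

/-- `ν_L < 1/2` (since `κ_L < 1/6`). [folklore] -/
theorem nu_lt_half {L : ℕ} (hL : 0 < L) : nu L < 1 / 2 := by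
  have hk := kappa_lt_one_sixth hL
  have hpos : 0 < 1 - 4 * kappa L := by linarith
  rw [nu, div_lt_iff₀ hpos]
  linarith

/-- `κ_L ≤ ν_L` and `0 < ν_L` for `L ≥ 2`. [folklore] -/
theorem kappa_le_nu {L : ℕ} (hL : 2 ≤ L) : kappa L ≤ nu L ∧ 0 < nu L := by
  have hk := kappa_lt_one_sixth (lt_of_lt_of_le (by norm_num) hL)
  have hk' := one_eighth_le_kappa hL
  have hpos : 0 < 1 - 4 * kappa L := by linarith
  have hle1 : 1 - 4 * kappa L ≤ 1 := by linarith
  refine ⟨?_, div_pos (by linarith) hpos⟩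
  rw [nu, le_div_iff₀ hpos]
  nlinarith

/-- `4 κ_L < 1`: the Neumann hypothesis `κ d < 1` of `norm_corrFactor_le` with `d = 4`. [folklore] -/
theorem four_kappa_lt_one {L : ℕ} (hL : 0 < L) : kappa L * 4 < 1 := by
  have hk := kappa_lt_one_sixth hL
  linarith

/-- `0 ≤ κ_L` for `L ≥ 1`. [folklore] -/
theorem kappa_nonneg {L : ℕ} (hL : 0 < L) : 0 ≤ kappa L := by
  have h1 : (1 : ℝ) ≤ L := by exact_mod_cast hL
  rw [kappa]
  apply div_nonneg (by nlinarith) (by positivity)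

/-- **The 1D model instance of the Neumann bound**: `‖Δ‖ ≤ 4` ⇒ `‖κ_L (1 − κ_LΔ)⁻¹‖ ≤ ν_L` (< 1/2). [folklore] -/
theorem norm_corrFactor_le_nu {A : Type*} [NormedRing A] [NormOneClass A] [HasSummableGeomSeries A]
    [NormedAlgebra ℝ A] {L : ℕ} (hL : 0 < L) (Δ : A) (hΔ : ‖Δ‖ ≤ 4) :
    ∃ h : ‖kappa L • Δ‖ < 1, ‖kappa L • (↑(Units.oneSub (kappa L • Δ) h)⁻¹ : A)‖ ≤ nu L := by
  obtain ⟨h, hle⟩ := norm_corrFactor_le (kappa_nonneg hL) (four_kappa_lt_one hL) Δ hΔ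
  refine ⟨h, hle.trans_eq ?_⟩
  rw [nu, mul_comm]

/-- **Symbol form** of `M = Δ·n·Δ`, `|n̂| ≤ ν_L`: for a Fourier multiplier value `s = Δ̂(p) ∈ [0, 4]` of the 1D
Laplacian (only `s ≤ 4` is used), the one-step correction symbol `M̂ = κ s²/(1 − κ s)` satisfies `0 ≤ M̂ ≤ ν_L · s²` —
quartic vanishing at
`p = 0` (`s ~ p²`) with the explicit constant; the record's [toy] value `M̂(p)/p⁴ → κ_L` (gen 1, §4.3) is the
leading term. [folklore] -/
theorem symbol_correction_le {L : ℕ} (hL : 0 < L) {s : ℝ} (hs4 : s ≤ 4) :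
    0 ≤ kappa L * s ^ 2 / (1 - kappa L * s) ∧ kappa L * s ^ 2 / (1 - kappa L * s) ≤ nu L * s ^ 2 := by
  have hk0 := kappa_nonneg hL
  have hk4 := four_kappa_lt_one hL
  have hden : 0 < 1 - kappa L * s := by nlinarith
  have hden' : 0 < 1 - 4 * kappa L := by linarith
  refine ⟨div_nonneg (by positivity) hden.le, ?_⟩
  rw [div_le_iff₀ hden, nu]
  have h1 : kappa L / (1 - 4 * kappa L) * s ^ 2 * (1 - kappa L * s)
      = kappa L * s ^ 2 * ((1 - kappa L * s) / (1 - 4 * kappa L)) := by ring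
  rw [h1]
  have h2 : 1 ≤ (1 - kappa L * s) / (1 - 4 * kappa L) := by
    rw [le_div_iff₀ hden']; nlinarith
  have h3 : 0 ≤ kappa L * s ^ 2 := by positivity
  nlinarith

/-! ## §3 The no-sheet bound in a normed group -/

section NoSheet

variable {E F : Type*} [SeminormedAddCommGroup E] [SeminormedAddCommGroup F]

/-- **No-sheet bound, potential level.** If `X = N J − Π (N J)` with `‖N f‖ ≤ ν‖f‖` and `‖Π f‖ ≤ C_Π ‖f‖`, then
`‖X‖ ≤ (1 + C_Π) ν ‖J‖`.  [model] Dictionary: `X` = the response `U_k(V) − Q₁U_{k+1}(V)` of the linearised model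
(lattice units), `J = J(W)` = the BARE current of the background minimiser `W`, `N = n` of §2, `Π` = linear
minimiser ∘ average; `ν = ν_L`, `C_Π` = an ℓ^∞ bound of printed TYPE ((9), first clause). [folklore] -/
theorem noSheet_norm_le {N Pm : E → E} {ν CP : ℝ} (hN : ∀ f, ‖N f‖ ≤ ν * ‖f‖) (hP : ∀ f, ‖Pm f‖ ≤ CP * ‖f‖)
    (hCP : 0 ≤ CP) {X J : E} (hX : X = N J - Pm (N J)) :
    ‖X‖ ≤ (1 + CP) * ν * ‖J‖ := by
  have h1 : ‖X‖ ≤ ‖N J‖ + ‖Pm (N J)‖ := by rw [hX]; exact norm_sub_le _ _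
  have h2 : ‖Pm (N J)‖ ≤ CP * ‖N J‖ := hP _
  have h3 : ‖N J‖ ≤ ν * ‖J‖ := hN _
  have h4 : CP * ‖N J‖ ≤ CP * (ν * ‖J‖) := mul_le_mul_of_nonneg_left h3 hCP
  nlinarith

/-- **No-sheet bound, gradient level.** With a "lattice gradient" `D : E → F`, `‖D f‖ ≤ C_D‖f‖` (in the model
`C_D = 2`) and `‖D (Π f)‖ ≤ C_Π′‖f‖` (printed TYPE: (9), second clause — one power of η better than needed), the
gradient of the response obeys `‖D X‖ ≤ (C_D + C_Π′) ν ‖J‖` — the SAME order as `‖X‖`: the face-layer jumps of the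
bare current cost nothing beyond the trivial `‖D‖ ≤ 2`. [folklore] -/
theorem noSheet_grad_norm_le {N Pm : E → E} {D : E → F} {ν CD CP' : ℝ} (hN : ∀ f, ‖N f‖ ≤ ν * ‖f‖)
    (hD : ∀ f, ‖D f‖ ≤ CD * ‖f‖) (hDP : ∀ f, ‖D (Pm f)‖ ≤ CP' * ‖f‖) (hCD : 0 ≤ CD) (hCP' : 0 ≤ CP')
    {X J : E} (hDX : D X = D (N J) - D (Pm (N J))) :
    ‖D X‖ ≤ (CD + CP') * ν * ‖J‖ := by
  have h1 : ‖D X‖ ≤ ‖D (N J)‖ + ‖D (Pm (N J))‖ := by rw [hDX]; exact norm_sub_le _ _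
  have h2 : ‖D (N J)‖ ≤ CD * ‖N J‖ := hD _
  have h3 : ‖D (Pm (N J))‖ ≤ CP' * ‖N J‖ := hDP _
  have h4 : ‖N J‖ ≤ ν * ‖J‖ := hN _
  have h5 : CD * ‖N J‖ ≤ CD * (ν * ‖J‖) := mul_le_mul_of_nonneg_left h4 hCD
  have h6 : CP' * ‖N J‖ ≤ CP' * (ν * ‖J‖) := mul_le_mul_of_nonneg_left h4 hCP'
  nlinarith

end NoSheet

/-! ## §3b The size consequence of the covariant factorisation (generation 3) -/

section CovSizes

variable {E : Type*} [SeminormedAddCommGroup E] [NormedSpace ℝ E]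

/-- **Covariant no-sheet bound.**  Linear operators on a seminormed space (`Module.End ℝ E`, a ring under
composition): from `𝔊Δ = 1 − Π`, `𝔊K = 0`, `M = Δ N + K E′ + R_M`, `‖Π f‖ ≤ C_Π‖f‖` and the two sizes
`‖N W‖ ≤ z`, `‖𝔊 (R_M W)‖ ≤ t` one gets `‖𝔊 (M W)‖ ≤ (1 + C_Π) z + t` — the single-level form of the third clause
of `LRRSized` (§4c; the two levels of (115) and the η-weights are the bookkeeping of `oneStepCorrectionRate_of_lrr`).
[model] `z` = pre-current size, `t` = the (117)-propagated tail. [folklore] -/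
theorem covFactorisation_norm_le {𝔊 Δ K Pm M N E' Rm : Module.End ℝ E} {CP z t : ℝ} (hCP : 0 ≤ CP)
    (h𝔊Δ : 𝔊 * Δ = 1 - Pm) (h𝔊K : 𝔊 * K = 0) (hM : M = Δ * N + K * E' + Rm)
    (hP : ∀ f, ‖Pm f‖ ≤ CP * ‖f‖) (W : E) (hz : ‖N W‖ ≤ z) (ht : ‖𝔊 (Rm W)‖ ≤ t) :
    ‖𝔊 (M W)‖ ≤ (1 + CP) * z + t := by
  have hid := propagated_correction_eq_cov h𝔊Δ h𝔊K hM
  have h1 : 𝔊 (M W) = (N W - Pm (N W)) + 𝔊 (Rm W) := by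
    have := congrArg (fun T : Module.End ℝ E => T W) hid
    simpa [Module.End.mul_apply, LinearMap.sub_apply, LinearMap.add_apply] using this
  rw [h1]
  calc ‖(N W - Pm (N W)) + 𝔊 (Rm W)‖ ≤ ‖N W - Pm (N W)‖ + ‖𝔊 (Rm W)‖ := norm_add_le _ _
    _ ≤ (‖N W‖ + ‖Pm (N W)‖) + t := add_le_add (norm_sub_le _ _) ht
    _ ≤ (z + CP * z) + t := by
        gcongr
        exact (hP _).trans (mul_le_mul_of_nonneg_left hz hCP)
    _ = (1 + CP) * z + t := by ring

end CovSizes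


/-! ## §4 The two-level (115) bookkeeping: an `OneStepCorrectionRate` with θ = L⁻¹ from sized hypotheses -/

section Bookkeeping

/-- **(115)-bookkeeping ⇒ OSC at rate `θ = L⁻¹` (model instance of the gen-1 wall shape).**  For each k and
each admissible datum V let `x k V` = sup-norm of the response in LATTICE units (potential level), `g k V` = sup-norm
of its lattice gradient, `j k V` = sup-norm of the bare lattice current of the background minimiser, and let the
(115)-reading be `osc k V = max (x/η) (g/η²)` with `η = (L⁻¹)^k` (potential `A = X̂/η`, `∇^η A = η⁻²∇̂X̂`, top-region
weights `(L^kη)^{1,2} = 1`).  IF `x ≤ (1 + C_Π) ν j` and `g ≤ (C_D + C_Π′) ν j` (§3) and `j ≤ B (η)³` (the current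
clause of the class (2) p. 278 for the minimiser, Theorem 1 (8): `B = B₃ε₁`, lattice current = η³ × physical
current), THEN `osc k V ≤ (1 + C_Π + C_D + C_Π′)·ν·B·(L⁻¹)^k`: the wall shape
`T4FixedPointResponse.OneStepCorrectionRate dom osc ρ L⁻¹` holds IN THE MODEL with an explicit ρ.  Every
hypothesis is a binder; nothing is asserted about Bałaban's objects. [folklore] -/
theorem oneStepCorrectionRate_of_noSheet {ι : Type*} {dom : Set ι} (x g j osc : ℕ → ι → ℝ)
    {L CP CD CP' ν B : ℝ} (hL : 1 ≤ L) (hCP : 0 ≤ CP) (hCD : 0 ≤ CD) (hCP' : 0 ≤ CP') (hν : 0 ≤ ν)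
    (hB : 0 ≤ B)
    (hx : ∀ k, ∀ V ∈ dom, x k V ≤ (1 + CP) * ν * j k V)
    (hg : ∀ k, ∀ V ∈ dom, g k V ≤ (CD + CP') * ν * j k V)
    (hj : ∀ k, ∀ V ∈ dom, j k V ≤ B * (L⁻¹ ^ k) ^ 3)
    (hosc : ∀ k, ∀ V ∈ dom, osc k V = max (x k V / L⁻¹ ^ k) (g k V / (L⁻¹ ^ k) ^ 2)) :
    OneStepCorrectionRate dom osc ((1 + CP + CD + CP') * ν * B) L⁻¹ := by
  intro k V hV
  have hL0 : 0 < L := lt_of_lt_of_le one_pos hL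
  set η : ℝ := L⁻¹ ^ k with hη
  have hη0 : 0 < η := pow_pos (inv_pos.mpr hL0) k
  have hη1 : η ≤ 1 := pow_le_one₀ (inv_nonneg.mpr hL0.le) (inv_le_one_of_one_le₀ hL)
  have hjk : j k V ≤ B * η ^ 3 := hj k V hV
  have hνB : 0 ≤ ν * B * η := by positivity
  have hx' : x k V ≤ (1 + CP) * ν * B * η ^ 3 := by
    have := hx k V hV
    have h2 : (1 + CP) * ν * j k V ≤ (1 + CP) * ν * (B * η ^ 3) :=
      mul_le_mul_of_nonneg_left hjk (by positivity)
    linarith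
  have hg' : g k V ≤ (CD + CP') * ν * B * η ^ 3 := by
    have := hg k V hV
    have h2 : (CD + CP') * ν * j k V ≤ (CD + CP') * ν * (B * η ^ 3) :=
      mul_le_mul_of_nonneg_left hjk (by positivity)
    linarith
  rw [hosc k V hV, ← hη]
  have hK : (1 + CP) ≤ (1 + CP + CD + CP') := by linarith
  have hK' : (CD + CP') ≤ (1 + CP + CD + CP') := by linarith
  apply max_le
  · rw [div_le_iff₀ hη0]
    have h3 : η ^ 3 ≤ η * η := by
      have : η ^ 3 = η * η * η := by ring
      rw [this]
      exact mul_le_of_le_one_right (by positivity) hη1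
    have h4 : (1 + CP) * ν * B * η ^ 3 ≤ (1 + CP) * ν * B * (η * η) :=
      mul_le_mul_of_nonneg_left h3 (by positivity)
    have h5 : (1 + CP) * ν * B * (η * η) ≤ (1 + CP + CD + CP') * ν * B * (η * η) := by
      have : 0 ≤ ν * B * (η * η) := by positivity
      nlinarith
    calc x k V ≤ (1 + CP + CD + CP') * ν * B * (η * η) := by linarith
      _ = (1 + CP + CD + CP') * ν * B * η * η := by ring
  · rw [div_le_iff₀ (by positivity)]
    have h4 : (CD + CP') * ν * B * η ^ 3 ≤ (1 + CP + CD + CP') * ν * B * η ^ 3 := by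
      have : 0 ≤ ν * B * η ^ 3 := by positivity
      nlinarith
    calc g k V ≤ (1 + CP + CD + CP') * ν * B * η ^ 3 := by linarith
      _ = (1 + CP + CD + CP') * ν * B * η * η ^ 2 := by ring

end Bookkeeping

/-! ## §4b The Laplacian-range representation (LRR) re-cut of OSC, with the logarithm absorbed

[model → wall]  The flat identity `X = (1 − Π)·n·J(W)` says what the MISSING estimate really is once the
symbol calculus is gone (curved class-(14) background, Bałaban's covariant averaging): a LAPLACIAN-RANGE
REPRESENTATION of the one-step correction current, `J^δ(W) = Δ_W Z + ζ + r` with `ζ ∈ Range K_W` (constraint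
forces, annihilated by 𝔊: `constrainedGreen_mul_constraint`), a "pre-current" `Z` of the size of the bare current
(`sup|Ẑ| ≤ C_Z·(1 + k·log L)·(printed current size)` — one logarithm admitted because in `d ≥ 2` the factor
`n = Δ⁻¹MΔ⁻¹` has a degree-0 homogeneous symbol `a₂(p)/|p|²`, a Calderón–Zygmund kernel on the torus of side
`L^k`, unless the quartic symbol of `M` is isotropic) and a tail `r` with `|r|_(−3) ≤ C_R·η` propagated
crudely by the printed (117) (`‖𝔊(W)r‖_(115) ≤ B₀|r|_(−3) ≤ B₀C_Rη`).  Then `osc_k ≤ ‖(1 − Π_W)Z‖_(115) + ‖𝔊(W)r‖_(115)`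
and the bookkeeping below gives `OneStepCorrectionRate` with the rate `θ′ = (1 + log L)/L < 1` (any `L ≥ 2`);
the consumers (`T4EtaRateMin.LocalRate.multiStep`) need `θ′ < 1` only.  Flat linearised 1D instance of LRR:
`Z = nJ(W)`, `ζ = r = 0`, `C_Z = ν_L`, no logarithm [§§1–2, 5].  Nothing printed is asserted. -/

section LogAbsorb

/-- `(1 + log L)/L < 1` for real `L ≥ 2` (`log L < L − 1` for `L ≠ 1`). [folklore] -/
theorem one_add_log_div_lt_one {L : ℝ} (hL : 2 ≤ L) : (1 + Real.log L) / L < 1 := by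
  have hL0 : 0 < L := by linarith
  rw [div_lt_one hL0]
  have := Real.log_lt_sub_one_of_pos hL0 (by linarith : L ≠ 1)
  linarith

/-- `0 ≤ (1 + log L)/L` for `L ≥ 1`. [folklore] -/
theorem one_add_log_div_nonneg {L : ℝ} (hL : 1 ≤ L) : 0 ≤ (1 + Real.log L) / L := by
  have := Real.log_nonneg hL
  positivity

/-- **Log absorption** (Bernoulli): `(1 + k·log L)·L^{−k} ≤ ((1 + log L)/L)^k` for `L ≥ 1`. [folklore] -/
theorem one_add_mul_log_mul_pow_le {L : ℝ} (hL : 1 ≤ L) (k : ℕ) :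
    (1 + k * Real.log L) * L⁻¹ ^ k ≤ ((1 + Real.log L) / L) ^ k := by
  have hlog : 0 ≤ Real.log L := Real.log_nonneg hL
  have h1 : 1 + k * Real.log L ≤ (1 + Real.log L) ^ k :=
    one_add_mul_le_pow (by linarith : (-2 : ℝ) ≤ Real.log L) k
  rw [div_eq_mul_inv, mul_pow]
  exact mul_le_mul_of_nonneg_right h1 (by positivity)

/-- `L^{−k} ≤ ((1 + log L)/L)^k` for `L ≥ 1` (the log-free terms ride along). [folklore] -/
theorem inv_pow_le_logRate_pow {L : ℝ} (hL : 1 ≤ L) (k : ℕ) :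
    L⁻¹ ^ k ≤ ((1 + Real.log L) / L) ^ k := by
  have hlog : 0 ≤ Real.log L := Real.log_nonneg hL
  have hL0 : 0 < L := by linarith
  apply pow_le_pow_left₀ (by positivity)
  rw [div_eq_mul_inv]
  have : (1 : ℝ) ≤ 1 + Real.log L := by linarith
  calc L⁻¹ = 1 * L⁻¹ := (one_mul _).symm
    _ ≤ (1 + Real.log L) * L⁻¹ := mul_le_mul_of_nonneg_right this (by positivity)

end LogAbsorb

section LRR

open T4FixedPointResponse

/-- **OSC from a Laplacian-range representation (sized bookkeeping, the typed re-cut of the wall).**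
[model] Dictionary, step k, `η = L^{−k}`, `W = U_k(V)`, lattice units on the top region (the cell's T⁴ setting has
the constant region sequence `Ω_j = T_η`, so only the `j = k` weights of (115) occur):
`z k V = sup|Ẑ(W)|` (pre-current of the LRR `J^δ(W) = Δ_W Z + ζ + r`), `t k V = ‖𝔊(W) r‖_(115)` (the tail, after
the printed (117)), `osc k V = ‖𝔊(W)𝔓J^δ(W)‖_(115) ≤ ‖(1 − Π_W)Z‖_(115) + t k V` with
`‖(1 − Π_W)Z‖_(115) ≤ max(η⁻¹(1 + C_Π) z, η⁻²·C_D(1 + C_Π) z) ≤ η⁻²(1 + C_D)(1 + C_Π) z` (`C_D = 2`: the lattice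
gradient is bounded by twice the sup; `C_Π`: sup-norm bound of the minimiser∘average projection, printed TYPE of
(9) clauses 1–2).  HYPOTHESES = the missing estimate LRR in sized form: `z ≤ C_Z·B·(1 + k log L)·η³` (B = the
printed current size constant, `B₃ε₁`-type, from (2) + Theorem 1 (8)), `t ≤ B₀·C_R·η` (`C_R ∝ ε₁²`; the
invariant count gives `η²`, one power to spare).
CONCLUSION: `OneStepCorrectionRate dom osc ρ θ′` with `θ′ = (1 + log L)/L`, `ρ = (1 + C_D)(1 + C_Π)C_Z B + B₀C_R`.
[cite: Balaban1985Variational, (115) p.294] -/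
theorem oneStepCorrectionRate_of_lrr {ι : Type*} {dom : Set ι} (z t osc : ℕ → ι → ℝ)
    {L CP CD CZ B B0 CR : ℝ} (hL : 1 ≤ L) (hCP : 0 ≤ CP) (hCD : 0 ≤ CD) (hCZ : 0 ≤ CZ) (hB : 0 ≤ B)
    (hB0 : 0 ≤ B0) (hCR : 0 ≤ CR)
    (hz : ∀ k, ∀ V ∈ dom, z k V ≤ CZ * B * (1 + k * Real.log L) * (L⁻¹ ^ k) ^ 3)
    (ht : ∀ k, ∀ V ∈ dom, t k V ≤ B0 * CR * L⁻¹ ^ k)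
    (hosc : ∀ k, ∀ V ∈ dom, osc k V ≤ (1 + CD) * (1 + CP) * z k V / (L⁻¹ ^ k) ^ 2 + t k V) :
    OneStepCorrectionRate dom osc ((1 + CD) * (1 + CP) * CZ * B + B0 * CR) ((1 + Real.log L) / L) := by
  intro k V hV
  set η : ℝ := L⁻¹ ^ k with hη
  set ϑ : ℝ := ((1 + Real.log L) / L) ^ k with hϑ
  have hL0 : 0 < L := by linarith
  have hη0 : 0 < η := by positivity
  have hη1 : η ≤ 1 := pow_le_one₀ (by positivity) (inv_le_one_of_one_le₀ hL)
  have hlog : 0 ≤ Real.log L := Real.log_nonneg hL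
  have hηϑ : η ≤ ϑ := inv_pow_le_logRate_pow hL k
  have hlogϑ : (1 + k * Real.log L) * η ≤ ϑ := one_add_mul_log_mul_pow_le hL k
  have hzk := hz k V hV
  have htk := ht k V hV
  have hA : 0 ≤ (1 + CD) * (1 + CP) := by positivity
  have hZB : 0 ≤ CZ * B := by positivity
  have h1 : (1 + CD) * (1 + CP) * z k V / η ^ 2 ≤ (1 + CD) * (1 + CP) * CZ * B * ϑ := by
    rw [div_le_iff₀ (by positivity)]
    have h1a : z k V ≤ CZ * B * ϑ * η ^ 2 := by
      calc z k V ≤ CZ * B * (1 + k * Real.log L) * η ^ 3 := hzk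
        _ = CZ * B * ((1 + k * Real.log L) * η) * η ^ 2 := by ring
        _ ≤ CZ * B * ϑ * η ^ 2 :=
          mul_le_mul_of_nonneg_right (mul_le_mul_of_nonneg_left hlogϑ hZB) (by positivity)
    calc (1 + CD) * (1 + CP) * z k V ≤ (1 + CD) * (1 + CP) * (CZ * B * ϑ * η ^ 2) :=
          mul_le_mul_of_nonneg_left h1a hA
      _ = (1 + CD) * (1 + CP) * CZ * B * ϑ * η ^ 2 := by ring
  have h2 : t k V ≤ B0 * CR * ϑ := htk.trans (mul_le_mul_of_nonneg_left hηϑ (by positivity))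
  calc osc k V ≤ (1 + CD) * (1 + CP) * z k V / η ^ 2 + t k V := hosc k V hV
    _ ≤ (1 + CD) * (1 + CP) * CZ * B * ϑ + B0 * CR * ϑ := add_le_add h1 h2
    _ = ((1 + CD) * (1 + CP) * CZ * B + B0 * CR) * ϑ := by ring

/-- The rate of `oneStepCorrectionRate_of_lrr` is a genuine rate: `0 ≤ θ′ < 1` for `L ≥ 2`, as the consumer
`T4EtaRateMin.LocalRate.multiStep` requires. [folklore] -/
theorem lrr_rate_lt_one {L : ℝ} (hL : 2 ≤ L) :
    0 ≤ (1 + Real.log L) / L ∧ (1 + Real.log L) / L < 1 :=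
  ⟨one_add_log_div_nonneg (by linarith), one_add_log_div_lt_one hL⟩

end LRR

/-! ## §4c The wall by name (generation 3): `LRRSized` and its consumers -/

section Wall

/-- **LRR, sized form — THE WALL OF NODE NE3 IN THE (115) CURRENCY, BY NAME.**  The conjunction of the three
hypotheses of `oneStepCorrectionRate_of_lrr`: pre-current size `z ≤ C_Z·B·(1 + k log L)·η³`, tail
`t ≤ B₀·C_R·η`, and the two-level (115) bookkeeping `osc ≤ (1 + C_D)(1 + C_Π) z η⁻² + t`, `η = L^{−k}`.  [model]
Reading as in §4b; records: GAPS G-ne3p1-7 ≡ G-ne3p2-1 ≡ G-ne5p1-2 (one statement, two currencies; the energy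
currency is `T4ConvexResponse.DefectDerivBound`).  A predicate — NOT PRINTED, never used as a fact. [folklore] -/
def LRRSized {ι : Type*} (dom : Set ι) (z t osc : ℕ → ι → ℝ) (L CP CD CZ B B0 CR : ℝ) : Prop :=
  (∀ k : ℕ, ∀ V ∈ dom, z k V ≤ CZ * B * (1 + k * Real.log L) * (L⁻¹ ^ k) ^ 3) ∧
  (∀ k : ℕ, ∀ V ∈ dom, t k V ≤ B0 * CR * L⁻¹ ^ k) ∧
  (∀ k : ℕ, ∀ V ∈ dom, osc k V ≤ (1 + CD) * (1 + CP) * z k V / (L⁻¹ ^ k) ^ 2 + t k V)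

/-- `LRRSized ⇒ OneStepCorrectionRate` with the log-absorbed rate `θ′ = (1 + log L)/L` (= `oneStepCorrectionRate_of_lrr`
applied to the three clauses). [folklore] -/
theorem oneStepCorrectionRate_of_lrrSized {ι : Type*} {dom : Set ι} {z t osc : ℕ → ι → ℝ}
    {L CP CD CZ B B0 CR : ℝ} (h : LRRSized dom z t osc L CP CD CZ B B0 CR)
    (hL : 1 ≤ L) (hCP : 0 ≤ CP) (hCD : 0 ≤ CD) (hCZ : 0 ≤ CZ) (hB : 0 ≤ B) (hB0 : 0 ≤ B0) (hCR : 0 ≤ CR) :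
    OneStepCorrectionRate dom osc ((1 + CD) * (1 + CP) * CZ * B + B0 * CR) ((1 + Real.log L) / L) :=
  oneStepCorrectionRate_of_lrr z t osc hL hCP hCD hCZ hB hB0 hCR h.1 h.2.1 h.2.2

/-- **Consumer-facing form: the wall by name ⇒ NE3's `LocalRate`.**  `LRRSized` + the gen-1 reading / response /
pairing hypotheses of `T4FixedPointResponse.localRate_of_oneStep'` give `T4EtaRateMin.LocalRate R C θ′`,
`θ′ = (1 + log L)/L`, `C = Λr·Γ·ρ + ρ₂` with `ρ = (1 + C_D)(1 + C_Π)C_Z B + B₀C_R`. [folklore] -/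
theorem localRate_of_lrrSized {ι X : Type*} {R : Readings ι X} {z t osc nrm pair : ℕ → ι → ℝ}
    {L CP CD CZ B B0 CR Γ Λr ρ₂ : ℝ} (h : LRRSized R.dom z t osc L CP CD CZ B B0 CR)
    (hL : 1 ≤ L) (hCP : 0 ≤ CP) (hCD : 0 ≤ CD) (hCZ : 0 ≤ CZ) (hB : 0 ≤ B) (hB0 : 0 ≤ B0) (hCR : 0 ≤ CR)
    (hΓ : 0 ≤ Γ) (hΛr : 0 ≤ Λr)
    (hread : ∀ k : ℕ, ∀ V ∈ R.dom, ∀ x : X,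
      |R.loc (k + 1) V x - R.loc k V x| ≤ Λr * nrm k V + pair k V)
    (hresp : ∀ k : ℕ, ∀ V ∈ R.dom, nrm k V ≤ Γ * osc k V)
    (hpair : OneStepCorrectionRate R.dom pair ρ₂ ((1 + Real.log L) / L)) :
    LocalRate R (Λr * Γ * ((1 + CD) * (1 + CP) * CZ * B + B0 * CR) + ρ₂) ((1 + Real.log L) / L) :=
  localRate_of_oneStep' nrm osc pair hΓ hΛr hread hresp
    (oneStepCorrectionRate_of_lrrSized h hL hCP hCD hCZ hB hB0 hCR) hpair

end Wall

/-! ## §4d Sharp log absorption (generation 3): any rate `L^{−a}`, `a < 1`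

[kernel arithmetic]  The Bernoulli absorption of §4b, `(1 + k log L)L^{−k} ≤ ((1 + log L)/L)^k`, is crude for
small `L`: `(1 + log L)/L` = 0.847, 0.6995, 0.597 for L = 2, 3, 4, while the sup reading (F) of node NE3 is
benchmarked against `L^{−1/3}` = 0.794, 0.693, 0.630.  The tangent-line inequality `1 + t ≤ eᵗ` at
`t = (1 − a)y − a` gives instead `(1 + y)e^{−y} ≤ (e^{−a}/(1 − a))e^{−ay}` for ALL real `y`, i.e.
`(1 + k log L)L^{−k} ≤ (e^{−a}/(1 − a))(L^{−a})^k`: every rate `L^{−a}`, `a < 1`, uniformly in `L > 0`, the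
logarithm costing only the constant `e^{−a}/(1 − a)`.  The LRR bookkeeping is repeated at this rate. -/

section SharpLog

/-- The tangent-line inequality behind the sharp log absorption: for every real `y` and every `a < 1`,
`1 + y ≤ (e^{−a}/(1 − a))·e^{(1 − a)y}` (from `1 + t ≤ eᵗ` at `t = (1 − a)y − a`). [folklore] -/
theorem one_add_le_exp_mul (y a : ℝ) (ha : a < 1) :
    1 + y ≤ Real.exp (-a) / (1 - a) * Real.exp ((1 - a) * y) := by
  have hb : 0 < 1 - a := by linarith
  have h := Real.add_one_le_exp ((1 - a) * y - a)
  rw [Real.exp_sub] at h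
  have h' : (1 - a) * (1 + y) ≤ Real.exp ((1 - a) * y) / Real.exp a := by linarith [h]
  rw [Real.exp_neg]
  calc 1 + y = ((1 - a) * (1 + y)) / (1 - a) := by field_simp
    _ ≤ (Real.exp ((1 - a) * y) / Real.exp a) / (1 - a) := div_le_div_of_nonneg_right h' hb.le
    _ = (Real.exp a)⁻¹ / (1 - a) * Real.exp ((1 - a) * y) := by ring

/-- **Sharp log absorption**: `(1 + k·log L)·L^{−k} ≤ (e^{−a}/(1 − a))·(L^{−a})^k` for every `L > 0`, every
`a < 1` and every `k` — any rate `L^{−a}` short of `L^{−1}`, at the price `e^{−a}/(1 − a)` in the constant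
(`a = 1/2`: `2e^{−1/2} ≈ 1.213`; `a = 2/3`: `3e^{−2/3} ≈ 1.540`). [folklore] -/
theorem one_add_mul_log_mul_pow_le_rpow {L a : ℝ} (hL : 0 < L) (ha : a < 1) (k : ℕ) :
    (1 + k * Real.log L) * L⁻¹ ^ k ≤ Real.exp (-a) / (1 - a) * (L ^ (-a)) ^ k := by
  set y : ℝ := k * Real.log L with hy
  have hpow : L⁻¹ ^ k = Real.exp (-y) := by
    rw [hy, Real.exp_neg, Real.exp_nat_mul, Real.exp_log hL, inv_pow]
  have hrpow : (L ^ (-a)) ^ k = Real.exp (-a * y) := by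
    rw [Real.rpow_def_of_pos hL, ← Real.exp_nat_mul, hy]
    congr 1; ring
  have hexp : Real.exp ((1 - a) * y) * Real.exp (-y) = Real.exp (-a * y) := by
    rw [← Real.exp_add]; congr 1; ring
  calc (1 + y) * L⁻¹ ^ k = (1 + y) * Real.exp (-y) := by rw [hpow]
    _ ≤ (Real.exp (-a) / (1 - a) * Real.exp ((1 - a) * y)) * Real.exp (-y) :=
        mul_le_mul_of_nonneg_right (one_add_le_exp_mul y a ha) (Real.exp_pos _).le
    _ = Real.exp (-a) / (1 - a) * (Real.exp ((1 - a) * y) * Real.exp (-y)) := by ring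
    _ = Real.exp (-a) / (1 - a) * Real.exp (-a * y) := by rw [hexp]
    _ = Real.exp (-a) / (1 - a) * (L ^ (-a)) ^ k := by rw [hrpow]

/-- `L^{−k} ≤ (L^{−a})^k` for `L ≥ 1`, `a ≤ 1` (the log-free terms ride along). [folklore] -/
theorem inv_pow_le_rpow_pow {L a : ℝ} (hL : 1 ≤ L) (ha : a ≤ 1) (k : ℕ) :
    L⁻¹ ^ k ≤ (L ^ (-a)) ^ k := by
  have hL0 : 0 < L := by linarith
  apply pow_le_pow_left₀ (by positivity)
  rw [← Real.rpow_neg_one]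
  exact Real.rpow_le_rpow_of_exponent_le hL (by linarith)

/-- The sharp rate is a genuine rate: `0 ≤ L^{−a} < 1` for `L > 1`, `a > 0`. [folklore] -/
theorem rpowRate_lt_one {L a : ℝ} (hL : 1 < L) (ha : 0 < a) : 0 ≤ L ^ (-a) ∧ L ^ (-a) < 1 :=
  ⟨Real.rpow_nonneg (by linarith) _, Real.rpow_lt_one_of_one_lt_of_neg hL (by linarith)⟩

/-- The constant of the sharp log absorption is positive. [folklore] -/
theorem logConst_pos {a : ℝ} (ha : a < 1) : 0 < Real.exp (-a) / (1 - a) :=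
  div_pos (Real.exp_pos _) (by linarith)

/-- **OSC from a Laplacian-range representation at ANY rate `L^{−a}`, `a < 1`.**  Same sized hypotheses as
`oneStepCorrectionRate_of_lrr`; conclusion `OneStepCorrectionRate dom osc ρ_a (L^{−a})` with
`ρ_a = (1 + C_D)(1 + C_Π)C_Z B·e^{−a}/(1 − a) + B₀C_R`.  [model] Why it matters: the Bernoulli rate
`(1 + log L)/L` of §4b equals 0.847 (L = 2), 0.6995 (L = 3), 0.597 (L = 4) and is WEAKER than the benchmark
`L^{−1/3}` = 0.794, 0.693, 0.630 of the sup reading (F) for L = 2, 3; this form gives `L^{−a}` for every fixed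
`a ∈ (1/3, 1)` and every `L`. [cite: Balaban1985Variational, (115) p.294] -/
theorem oneStepCorrectionRate_of_lrr_rpow {ι : Type*} {dom : Set ι} (z t osc : ℕ → ι → ℝ)
    {L a CP CD CZ B B0 CR : ℝ} (hL : 1 ≤ L) (ha : a < 1) (hCP : 0 ≤ CP) (hCD : 0 ≤ CD) (hCZ : 0 ≤ CZ)
    (hB : 0 ≤ B) (hB0 : 0 ≤ B0) (hCR : 0 ≤ CR)
    (hz : ∀ k, ∀ V ∈ dom, z k V ≤ CZ * B * (1 + k * Real.log L) * (L⁻¹ ^ k) ^ 3)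
    (ht : ∀ k, ∀ V ∈ dom, t k V ≤ B0 * CR * L⁻¹ ^ k)
    (hosc : ∀ k, ∀ V ∈ dom, osc k V ≤ (1 + CD) * (1 + CP) * z k V / (L⁻¹ ^ k) ^ 2 + t k V) :
    OneStepCorrectionRate dom osc
      ((1 + CD) * (1 + CP) * CZ * B * (Real.exp (-a) / (1 - a)) + B0 * CR) (L ^ (-a)) := by
  intro k V hV
  set η : ℝ := L⁻¹ ^ k with hη
  set ϑ : ℝ := (L ^ (-a)) ^ k with hϑ
  set c : ℝ := Real.exp (-a) / (1 - a) with hc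
  have hL0 : 0 < L := by linarith
  have hη0 : 0 < η := by positivity
  have hc0 : 0 < c := logConst_pos ha
  have hϑ0 : 0 ≤ ϑ := pow_nonneg (Real.rpow_nonneg hL0.le _) k
  have hηϑ : η ≤ ϑ := inv_pow_le_rpow_pow hL ha.le k
  have hlogϑ : (1 + k * Real.log L) * η ≤ c * ϑ := one_add_mul_log_mul_pow_le_rpow hL0 ha k
  have hzk := hz k V hV
  have htk := ht k V hV
  have hA : 0 ≤ (1 + CD) * (1 + CP) := by positivity
  have hZB : 0 ≤ CZ * B := by positivity
  have h1 : (1 + CD) * (1 + CP) * z k V / η ^ 2 ≤ (1 + CD) * (1 + CP) * CZ * B * c * ϑ := by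
    rw [div_le_iff₀ (by positivity)]
    have h1a : z k V ≤ CZ * B * (c * ϑ) * η ^ 2 := by
      calc z k V ≤ CZ * B * (1 + k * Real.log L) * η ^ 3 := hzk
        _ = CZ * B * ((1 + k * Real.log L) * η) * η ^ 2 := by ring
        _ ≤ CZ * B * (c * ϑ) * η ^ 2 :=
          mul_le_mul_of_nonneg_right (mul_le_mul_of_nonneg_left hlogϑ hZB) (by positivity)
    calc (1 + CD) * (1 + CP) * z k V ≤ (1 + CD) * (1 + CP) * (CZ * B * (c * ϑ) * η ^ 2) :=
          mul_le_mul_of_nonneg_left h1a hA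
      _ = (1 + CD) * (1 + CP) * CZ * B * c * ϑ * η ^ 2 := by ring
  have h2 : t k V ≤ B0 * CR * ϑ := htk.trans (mul_le_mul_of_nonneg_left hηϑ (by positivity))
  calc osc k V ≤ (1 + CD) * (1 + CP) * z k V / η ^ 2 + t k V := hosc k V hV
    _ ≤ (1 + CD) * (1 + CP) * CZ * B * c * ϑ + B0 * CR * ϑ := add_le_add h1 h2
    _ = ((1 + CD) * (1 + CP) * CZ * B * c + B0 * CR) * ϑ := by ring

/-- The wall by name at any rate `L^{−a}`: `LRRSized` ⟹ `OneStepCorrectionRate … (L^{−a})`. [folklore] -/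
theorem oneStepCorrectionRate_of_lrrSized_rpow {ι : Type*} {dom : Set ι} {z t osc : ℕ → ι → ℝ}
    {L CP CD CZ B B0 CR : ℝ} (h : LRRSized dom z t osc L CP CD CZ B B0 CR) {a : ℝ}
    (hL : 1 ≤ L) (ha : a < 1) (hCP : 0 ≤ CP) (hCD : 0 ≤ CD) (hCZ : 0 ≤ CZ) (hB : 0 ≤ B) (hB0 : 0 ≤ B0)
    (hCR : 0 ≤ CR) :
    OneStepCorrectionRate dom osc
      ((1 + CD) * (1 + CP) * CZ * B * (Real.exp (-a) / (1 - a)) + B0 * CR) (L ^ (-a)) :=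
  oneStepCorrectionRate_of_lrr_rpow z t osc hL ha hCP hCD hCZ hB hB0 hCR h.1 h.2.1 h.2.2

/-- Consumer-facing sharp form: `LRRSized` + the gen-1 reading / response / pairing hypotheses ⟹
`T4EtaRateMin.LocalRate R C_a (L^{−a})` for every `a < 1`. [folklore] -/
theorem localRate_of_lrrSized_rpow {ι X : Type*} {R : Readings ι X} {z t osc nrm pair : ℕ → ι → ℝ}
    {L CP CD CZ B B0 CR Γ Λr ρ₂ a : ℝ} (h : LRRSized R.dom z t osc L CP CD CZ B B0 CR)
    (hL : 1 ≤ L) (ha : a < 1) (hCP : 0 ≤ CP) (hCD : 0 ≤ CD) (hCZ : 0 ≤ CZ) (hB : 0 ≤ B) (hB0 : 0 ≤ B0)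
    (hCR : 0 ≤ CR) (hΓ : 0 ≤ Γ) (hΛr : 0 ≤ Λr)
    (hread : ∀ k : ℕ, ∀ V ∈ R.dom, ∀ x : X,
      |R.loc (k + 1) V x - R.loc k V x| ≤ Λr * nrm k V + pair k V)
    (hresp : ∀ k : ℕ, ∀ V ∈ R.dom, nrm k V ≤ Γ * osc k V)
    (hpair : OneStepCorrectionRate R.dom pair ρ₂ (L ^ (-a))) :
    LocalRate R (Λr * Γ * ((1 + CD) * (1 + CP) * CZ * B * (Real.exp (-a) / (1 - a)) + B0 * CR) + ρ₂)
      (L ^ (-a)) :=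
  localRate_of_oneStep' nrm osc pair hΓ hΛr hread hresp
    (oneStepCorrectionRate_of_lrrSized_rpow h hL ha hCP hCD hCZ hB hB0 hCR) hpair

end SharpLog

/-! ## §4e The node's two-reading shape by name (v1.3): `LRRSized ⇒ T4EtaRateMin.NE3Shape`

[kernel bookkeeping]  `T4EtaRateMin.NE3Shape R C θ` is the conjunction `0 ≤ θ < 1 ∧ ActionRate R C θ ∧ LocalRate R C θ`.
The `LocalRate` clause is §4c / §4d; the rate bounds are `lrr_rate_lt_one` / `rpowRate_lt_one`; the `ActionRate`
clause is `T4EtaRateMin.actionRate_of_localRate` under its printed-meaning hypothesis (the scalar reading is the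
sum of the local readings over the finitely many unit-scale sites, at most `vol` of them — the factor |T₁| of NE3's
action-value clause).  No new mathematics: the point is that the consumer's predicate is reached BY NAME. -/

section ShapeByName

open Literature.MathematicalPhysics.QuantumFieldTheory.Balaban1983to89.T4EtaRateMin
  (NE3Shape actionRate_of_localRate)

/-- **The wall by name ⇒ the node's shape by name, log-absorbed rate.**  `LRRSized` + reading / response / pairing
+ «act = Σ_x loc, card X ≤ vol» give `NE3Shape R C θ′`, `θ′ = (1 + log L)/L`, for `L ≥ 2`,
`C = Λr·Γ·((1 + C_D)(1 + C_Π)C_Z B + B₀C_R) + ρ₂`. [folklore] -/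
theorem ne3Shape_of_lrrSized {ι X : Type*} [Fintype X] {R : Readings ι X} {z t osc nrm pair : ℕ → ι → ℝ}
    {L CP CD CZ B B0 CR Γ Λr ρ₂ : ℝ} (h : LRRSized R.dom z t osc L CP CD CZ B B0 CR)
    (hL : 2 ≤ L) (hCP : 0 ≤ CP) (hCD : 0 ≤ CD) (hCZ : 0 ≤ CZ) (hB : 0 ≤ B) (hB0 : 0 ≤ B0) (hCR : 0 ≤ CR)
    (hΓ : 0 ≤ Γ) (hΛr : 0 ≤ Λr) (hρ₂ : 0 ≤ ρ₂)
    (hact : ∀ k : ℕ, ∀ V ∈ R.dom, R.act k V = ∑ x, R.loc k V x) (hvol : (Fintype.card X : ℝ) ≤ R.vol)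
    (hread : ∀ k : ℕ, ∀ V ∈ R.dom, ∀ x : X,
      |R.loc (k + 1) V x - R.loc k V x| ≤ Λr * nrm k V + pair k V)
    (hresp : ∀ k : ℕ, ∀ V ∈ R.dom, nrm k V ≤ Γ * osc k V)
    (hpair : OneStepCorrectionRate R.dom pair ρ₂ ((1 + Real.log L) / L)) :
    NE3Shape R (Λr * Γ * ((1 + CD) * (1 + CP) * CZ * B + B0 * CR) + ρ₂) ((1 + Real.log L) / L) := by
  have hloc := localRate_of_lrrSized h (by linarith) hCP hCD hCZ hB hB0 hCR hΓ hΛr hread hresp hpair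
  obtain ⟨h0, h1⟩ := lrr_rate_lt_one hL
  have hC : 0 ≤ Λr * Γ * ((1 + CD) * (1 + CP) * CZ * B + B0 * CR) + ρ₂ := by positivity
  exact ⟨h0, h1, actionRate_of_localRate hact hvol hC h0 hloc, hloc⟩

/-- **The wall by name ⇒ the node's shape by name, rate `L^{−a}`.**  Same, at any `0 < a < 1` and `L > 1`, with
the constant of `localRate_of_lrrSized_rpow`. [folklore] -/
theorem ne3Shape_of_lrrSized_rpow {ι X : Type*} [Fintype X] {R : Readings ι X} {z t osc nrm pair : ℕ → ι → ℝ}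
    {L CP CD CZ B B0 CR Γ Λr ρ₂ a : ℝ} (h : LRRSized R.dom z t osc L CP CD CZ B B0 CR)
    (hL : 1 < L) (ha0 : 0 < a) (ha : a < 1) (hCP : 0 ≤ CP) (hCD : 0 ≤ CD) (hCZ : 0 ≤ CZ) (hB : 0 ≤ B)
    (hB0 : 0 ≤ B0) (hCR : 0 ≤ CR) (hΓ : 0 ≤ Γ) (hΛr : 0 ≤ Λr) (hρ₂ : 0 ≤ ρ₂)
    (hact : ∀ k : ℕ, ∀ V ∈ R.dom, R.act k V = ∑ x, R.loc k V x) (hvol : (Fintype.card X : ℝ) ≤ R.vol)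
    (hread : ∀ k : ℕ, ∀ V ∈ R.dom, ∀ x : X,
      |R.loc (k + 1) V x - R.loc k V x| ≤ Λr * nrm k V + pair k V)
    (hresp : ∀ k : ℕ, ∀ V ∈ R.dom, nrm k V ≤ Γ * osc k V)
    (hpair : OneStepCorrectionRate R.dom pair ρ₂ (L ^ (-a))) :
    NE3Shape R (Λr * Γ * ((1 + CD) * (1 + CP) * CZ * B * (Real.exp (-a) / (1 - a)) + B0 * CR) + ρ₂)
      (L ^ (-a)) := by
  have hloc := localRate_of_lrrSized_rpow h hL.le ha hCP hCD hCZ hB hB0 hCR hΓ hΛr hread hresp hpair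
  obtain ⟨h0, h1⟩ := rpowRate_lt_one hL ha0
  have hlog := logConst_pos ha
  have h1CD : (0 : ℝ) ≤ 1 + CD := by linarith
  have h1CP : (0 : ℝ) ≤ 1 + CP := by linarith
  have hC : 0 ≤ Λr * Γ * ((1 + CD) * (1 + CP) * CZ * B * (Real.exp (-a) / (1 - a)) + B0 * CR) + ρ₂ :=
    add_nonneg (mul_nonneg (mul_nonneg hΛr hΓ) (add_nonneg
      (mul_nonneg (mul_nonneg (mul_nonneg (mul_nonneg h1CD h1CP) hCZ) hB) hlog.le) (mul_nonneg hB0 hCR))) hρ₂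
  exact ⟨h0, h1, actionRate_of_localRate hact hvol hC h0 hloc, hloc⟩

end ShapeByName

/-! ## §5 The 1D periodic model: block second moment = κ_L and the block average of the Green function -/

section OneD

/-- `Σ_{i<n} i = n(n − 1)/2` over ℝ — the ℝ-cast of Mathlib's `Finset.sum_range_id_mul_two`. [folklore] -/
theorem sum_range_id_real (n : ℕ) : ∑ i ∈ range n, (i : ℝ) = (n : ℝ) * ((n : ℝ) - 1) / 2 := by
  have h := Finset.sum_range_id_mul_two n
  cases n with
  | zero => simp
  | succ m =>
    rw [Nat.add_sub_cancel] at h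
    have h' : (((∑ i ∈ range (m + 1), i : ℕ) : ℝ)) * 2 = (((m + 1) * m : ℕ) : ℝ) := by exact_mod_cast h
    push_cast at h' ⊢
    linarith

/-- **Block second moment.** `Σ_{i,j<L} (i − j)² = L²(L² − 1)/6`, from the β sub-cell's one-line moment sum
`Beta.ElimJacobianAlgebra.sum_range_sq_sub` (`Σ_{i<L} (i − a)²` in closed form). [folklore] -/
theorem sum_sum_sub_sq (L : ℕ) :
    ∑ i ∈ range L, ∑ j ∈ range L, ((i : ℝ) - j) ^ 2 = (L : ℝ) ^ 2 * ((L : ℝ) ^ 2 - 1) / 6 := by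
  have h1 : ∀ i ∈ range L, ∑ j ∈ range L, ((i : ℝ) - j) ^ 2
      = (L : ℝ) * ((L : ℝ) - 1) * (2 * (L : ℝ) - 1) / 6 - 2 * (i : ℝ) * ((L : ℝ) * ((L : ℝ) - 1) / 2)
        + (L : ℝ) * (i : ℝ) ^ 2 := by
    intro i _
    rw [← sum_range_sq_sub L (i : ℝ)]
    exact Finset.sum_congr rfl (fun (j : ℕ) _ => by ring)
  have h2 : ∑ i ∈ range L, (i : ℝ) ^ 2 = (L : ℝ) * ((L : ℝ) - 1) * (2 * (L : ℝ) - 1) / 6 := by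
    simpa using sum_range_sq_sub L 0
  have h3 : ∑ i ∈ range L, 2 * (i : ℝ) * ((L : ℝ) * ((L : ℝ) - 1) / 2)
      = (∑ i ∈ range L, (i : ℝ)) * (2 * ((L : ℝ) * ((L : ℝ) - 1) / 2)) := by
    rw [Finset.sum_mul]
    exact Finset.sum_congr rfl (fun (i : ℕ) _ => by ring)
  rw [Finset.sum_congr rfl h1, Finset.sum_add_distrib, Finset.sum_sub_distrib, Finset.sum_const,
    Finset.card_range, nsmul_eq_mul, h3, sum_range_id_real, ← Finset.mul_sum, h2]
  ring

/-- Hence the normalised block second moment is EXACTLY κ_L: `(1/L²) Σ_{i,j<L} ((i − j)/L)² = (L² − 1)/(6L²)` —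
the companion of `T4OneStepKernel1D.blockAvgAbs_self` (`(1/L²) ΣΣ |i − j|/L = 2κ_L`). [folklore] -/
theorem blockAvgSq_eq_kappa {L : ℕ} (hL : 0 < L) :
    (1 / (L : ℝ) ^ 2) * ∑ i ∈ range L, ∑ j ∈ range L, (((i : ℝ) - j) / L) ^ 2 = kappa L := by
  have hL' : (L : ℝ) ≠ 0 := by exact_mod_cast hL.ne'
  have h : ∀ i j : ℕ, (((i : ℝ) - j) / L) ^ 2 = ((i : ℝ) - j) ^ 2 / (L : ℝ) ^ 2 := fun i j => by rw [div_pow]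
  simp_rw [h, ← Finset.sum_div, sum_sum_sub_sq]
  rw [kappa]
  field_simp

/-- The 1D periodic Green function of the lattice Laplacian with the zero mode removed, written as a function of
the (signed) distance t on a cycle of length N (valid for |t| ≤ N; C¹ at the antipode): `g_N(t) = −|t|/2 + t²/(2N)`,
`(−Δg)… = δ₀ − 1/N`. [folklore] -/
noncomputable def green (N t : ℝ) : ℝ := -|t| / 2 + t ^ 2 / (2 * N)

/-- `Δ g_N = δ₀ − 1/N` at integer points: `2g(t) − g(t+1) − g(t−1) = [t = 0] − 1/N`. [folklore] -/
theorem green_laplacian (N : ℝ) (hN : N ≠ 0) (t : ℤ) :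
    2 * green N t - green N ((t : ℝ) + 1) - green N ((t : ℝ) - 1) = (if t = 0 then 1 else 0) - 1 / N := by
  have habs : 2 * |(t : ℝ)| - |(t : ℝ) + 1| - |(t : ℝ) - 1| = -2 * (if t = 0 then 1 else 0) := by
    rcases lt_trichotomy t 0 with ht | ht | ht
    · have h1 : (t : ℝ) + 1 ≤ 0 := by exact_mod_cast ht
      have h2 : (t : ℝ) < 0 := by exact_mod_cast ht
      rw [abs_of_neg h2, abs_of_nonpos h1, abs_of_neg (by linarith), if_neg ht.ne]; ring
    · subst ht; simp; norm_num
    · have h1 : (1 : ℝ) ≤ (t : ℝ) := by exact_mod_cast ht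
      rw [abs_of_pos (by linarith), abs_of_pos (by linarith), abs_of_nonneg (by linarith), if_neg ht.ne']; ring
  simp only [green]
  have : (2 * (-|(t : ℝ)| / 2 + (t : ℝ) ^ 2 / (2 * N)) - (-|(t : ℝ) + 1| / 2 + ((t : ℝ) + 1) ^ 2 / (2 * N))
      - (-|(t : ℝ) - 1| / 2 + ((t : ℝ) - 1) ^ 2 / (2 * N)))
      = -(2 * |(t : ℝ)| - |(t : ℝ) + 1| - |(t : ℝ) - 1|) / 2 - 1 / N := by
    field_simp; ring
  rw [this, habs]; ring

/-- **Block average of the fine Green function (the exact one-step Schur complement in 1D).**  With fine period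
`LN`, coarse period `N`, block means over blocks of `L` consecutive fine sites, and coarse separation `t`:
`(1/L²) Σ_{i,j<L} g_{LN}(Lt + i − j) = L·( g_N(t) + κ_L/(2N) − κ_L·[t = 0] )`.
[model] Dictionary: with the physical normalisations (fine spacing 1/L, `Q* = L·Qᵀ` the ℓ²-adjoint of the block
mean) the left side divided by L is the kernel of `S = Q G_f Q*`; the constant `κ_L/(2N)` is a multiple of the
all-ones kernel (invisible on mean-zero functions), so ON MEAN-ZERO LATTICE FUNCTIONS `S = G_c − κ_L·1` EXACTLY —
the hypothesis `hS` of `schur_mul_effLaplacian` with `P` = the projection onto constants; hence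
`Δ^eff = Δ_c(1 − κ_LΔ_c)⁻¹` and `M = Δ_c·n·Δ_c`, `n = κ_L(1 − κ_LΔ_c)⁻¹` (`correction_eq_lap_mul_lap`). [folklore] -/
theorem blockAvg_green {L : ℕ} (hL : 0 < L) (N : ℝ) (hN : N ≠ 0) (t : ℤ) :
    (1 / (L : ℝ) ^ 2) * ∑ i ∈ range L, ∑ j ∈ range L, green ((L : ℝ) * N) ((L : ℝ) * t + ((i : ℝ) - j))
      = (L : ℝ) * (green N t + kappa L / (2 * N) - (if t = 0 then kappa L else 0)) := by
  have hL' : (0 : ℝ) < L := by exact_mod_cast hL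
  have hLne : (L : ℝ) ≠ 0 := hL'.ne'
  -- pointwise: g_{LN}(Lt + (i−j)) = −(L/2)|t + (i−j)/L| + (Lt + (i−j))²/(2LN)
  have hpt : ∀ i j : ℕ, green ((L : ℝ) * N) ((L : ℝ) * t + ((i : ℝ) - j))
      = -((L : ℝ) / 2) * |(t : ℝ) - (0 : ℤ) + ((i : ℝ) - j) / L|
        + (1 / (2 * ((L : ℝ) * N))) * ((L : ℝ) * t + ((i : ℝ) - j)) ^ 2 := by
    intro i j
    have e1 : (L : ℝ) * t + ((i : ℝ) - j) = (L : ℝ) * ((t : ℝ) - (0 : ℤ) + ((i : ℝ) - j) / L) := by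
      push_cast; field_simp; ring
    rw [green, e1, abs_mul, abs_of_pos hL']
    field_simp
  simp_rw [hpt, Finset.sum_add_distrib, ← Finset.mul_sum, mul_add]
  -- the |·| part is L² · blockAvgAbs L t 0
  have hS : ∑ i ∈ range L, ∑ j ∈ range L, |(t : ℝ) - (0 : ℤ) + ((i : ℝ) - j) / L|
      = (L : ℝ) ^ 2 * blockAvgAbs L t 0 := by
    rw [blockAvgAbs]; field_simp
  -- the square part
  have hsq : ∑ i ∈ range L, ∑ j ∈ range L, ((L : ℝ) * t + ((i : ℝ) - j)) ^ 2
      = (L : ℝ) ^ 2 * ((L : ℝ) * t) ^ 2 + (L : ℝ) ^ 2 * ((L : ℝ) ^ 2 - 1) / 6 := by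
    have e2 : ∀ i j : ℕ, ((L : ℝ) * t + ((i : ℝ) - j)) ^ 2
        = ((L : ℝ) * t) ^ 2 + 2 * ((L : ℝ) * t) * ((i : ℝ) - j) + ((i : ℝ) - j) ^ 2 := fun i j => by ring
    simp_rw [e2, Finset.sum_add_distrib, Finset.sum_const, Finset.card_range, nsmul_eq_mul, ← Finset.mul_sum,
      sum_sum_sub_eq_zero, sum_sum_sub_sq]
    ring
  rw [hS, hsq, blockAvgAbs_eq hL t 0]
  by_cases ht : t = 0
  · subst ht
    simp only [if_true, Int.cast_zero, sub_zero, abs_zero, green, kappa, mul_zero]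
    field_simp; ring
  · simp only [if_neg ht, Int.cast_zero, sub_zero, green, kappa, add_zero]
    field_simp; ring

end OneD

/-! ## §5b The quartic defect symbol (generation 3: closed form CONJECTURED from the two-engine toy)

[numerics → model; nothing here is a theorem about Bałaban's operators]  For the printed LINEAR averaging of
1-forms ([Balaban1984PropagatorsI] (1.6)–(1.8), = the linear term of (15) of [Balaban1985Averaging]) and the Wilson
quadratic forms, the toy `a2_symbol_toy.py` (two independent engines agreeing to ≤ 4.2e−15) finds that the transverse
block of the one-step defect `M(P) = L⁴K_eff(P) − K_c(P)` is `O(|P|⁴)` (no cubic part, no gauge leakage) and that its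
quartic symbol on polarisations `ε ⊥ ξ` is, to ≤ 2·10⁻⁷ (the Richardson error of the extracted coefficient; 1e−8 at
L = 2; scalars 3.9e−10) on random directions for d = 2, 3, 4, L = 2, 3, 4 and both
staircase orders, the polynomial `quarticDefectForm κ_L ξ ε` below; for scalar block means it is
`quarticDefectScalar κ_L ξ` (gen-1 toy: 0.125 on the axis vs 0.09375 on the diagonal, d = 2, L = 2 — the values of
`quarticDefectScalar (kappa 2)` at e₁ and at (e₁ + e₂)/√2).  The kernel facts below are identities of these
polynomials; their MEANING (which leaf the covariant estimate must feed) is in the module docstring. -/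

section QuarticSymbol

variable {d : ℕ}

/-- `|ξ|² = Σ_μ ξ_μ²`. [folklore] -/
def s2 (ξ : Fin d → ℝ) : ℝ := ∑ μ, ξ μ ^ 2

/-- The cubic-lattice invariant `Σ_μ ξ_μ⁴`. [folklore] -/
def s4 (ξ : Fin d → ℝ) : ℝ := ∑ μ, ξ μ ^ 4

/-- The mixed invariant `Σ_μ ξ_μ² ε_μ²` (momentum ξ, polarisation ε). [folklore] -/
def s22 (ξ ε : Fin d → ℝ) : ℝ := ∑ μ, ξ μ ^ 2 * ε μ ^ 2

/-- Conjectured quartic defect symbol of scalar block means: `(κ/2)(|ξ|⁴ + Σ_μ ξ_μ⁴)` (an explicit polynomial;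
the conjecture is the dictionary, not the definition). [model] [folklore] -/
noncomputable def quarticDefectScalar (κ : ℝ) (ξ : Fin d → ℝ) : ℝ :=
  κ / 2 * (s2 ξ ^ 2 + s4 ξ)

/-- Conjectured quartic defect symbol of the linear averaging (1.8) on 1-forms, as a quadratic form in the
polarisation ε (to be read on `ε ⊥ ξ`): `(κ/2)[(|ξ|⁴ + Σ_μ ξ_μ⁴)|ε|² + |ξ|² Σ_μ ξ_μ²ε_μ²]` (an explicit
polynomial; the conjecture is the dictionary, not the definition). [model] [folklore] -/
noncomputable def quarticDefectForm (κ : ℝ) (ξ ε : Fin d → ℝ) : ℝ :=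
  κ / 2 * ((s2 ξ ^ 2 + s4 ξ) * s2 ε + s2 ξ * s22 ξ ε)

/-- d = 1: the scalar symbol is `κ|ξ|⁴` — the exact 1D constant κ_L of `T4OneStepKernel1D` / §5. [folklore] -/
theorem quarticDefectScalar_one_dim (κ : ℝ) (ξ : Fin 1 → ℝ) :
    quarticDefectScalar κ ξ = κ * s2 ξ ^ 2 := by
  simp only [quarticDefectScalar, s2, s4, Fin.sum_univ_one]
  ring

/-- **d = 2: the 1-form symbol is ISOTROPIC on transverse polarisations**, `κ|ξ|⁴|ε|²` whenever `ε ⊥ ξ`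
(`(a² − b²)(ap − bq)(ap + bq)` is the difference).  [model] Meaning: the 2D linearised defect is the LOCAL operator
`κ_L Δ·d*d` — no Calderón–Zygmund factor, no logarithm. [folklore] -/
theorem quarticDefectForm_two_dim (κ : ℝ) (ξ ε : Fin 2 → ℝ) (h : ξ 0 * ε 0 + ξ 1 * ε 1 = 0) :
    quarticDefectForm κ ξ ε = κ * s2 ξ ^ 2 * s2 ε := by
  simp only [quarticDefectForm, s2, s4, s22, Fin.sum_univ_two]
  linear_combination (κ / 2 * (ξ 0 ^ 2 - ξ 1 ^ 2) * (ξ 0 * ε 0 - ξ 1 * ε 1)) * h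

/-- Scalar block means, d = 2: normalised symbol κ on the axis and 3κ/4 on the diagonal (the gen-1 toy's
0.125 vs 0.09375 at L = 2). [folklore] -/
theorem quarticDefectScalar_axis_diag (κ : ℝ) :
    quarticDefectScalar κ ![1, 0] = κ * s2 ![(1 : ℝ), 0] ^ 2 ∧
    quarticDefectScalar κ ![1, 1] = 3 / 4 * κ * s2 ![(1 : ℝ), 1] ^ 2 := by
  simp only [quarticDefectScalar, s2, s4, Fin.sum_univ_two, Matrix.cons_val_zero, Matrix.cons_val_one]
  constructor <;> ring

/-- **d = 3: the 1-form symbol is ANISOTROPIC** — normalised value κ at (ξ, ε) = (e₁, e₂), 3κ/4 at (e₁ + e₂, e₃).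
[model] Meaning: the degree-0 part of `n = MΔ⁻²` contains second Riesz transforms; one logarithm (§4b). [folklore] -/
theorem quarticDefectForm_anisotropic (κ : ℝ) :
    quarticDefectForm κ ![1, 0, 0] ![0, 1, 0] = κ * (s2 ![(1 : ℝ), 0, 0] ^ 2 * s2 ![(0 : ℝ), 1, 0]) ∧
    quarticDefectForm κ ![1, 1, 0] ![0, 0, 1] = 3 / 4 * κ * (s2 ![(1 : ℝ), 1, 0] ^ 2 * s2 ![(0 : ℝ), 0, 1]) := by
  simp only [quarticDefectForm, s2, s4, s22, Fin.sum_univ_three, Matrix.cons_val_zero, Matrix.cons_val_one,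
    Matrix.head_cons, Matrix.cons_val_two, Matrix.tail_cons]
  constructor <;> ring

/-- Hence, for κ ≠ 0, the normalised symbol is not constant on (ξ, ε ⊥ ξ). [folklore] -/
theorem quarticDefectForm_not_isotropic {κ : ℝ} (hκ : κ ≠ 0) :
    quarticDefectForm κ ![1, 1, 0] ![0, 0, 1] / (s2 ![(1 : ℝ), 1, 0] ^ 2 * s2 ![(0 : ℝ), 0, 1]) ≠
    quarticDefectForm κ ![1, 0, 0] ![0, 1, 0] / (s2 ![(1 : ℝ), 0, 0] ^ 2 * s2 ![(0 : ℝ), 1, 0]) := by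
  obtain ⟨h1, h2⟩ := quarticDefectForm_anisotropic κ
  have hs1 : s2 ![(1 : ℝ), 0, 0] ^ 2 * s2 ![(0 : ℝ), 1, 0] = 1 := by
    simp [s2, Fin.sum_univ_three]
  have hs2 : s2 ![(1 : ℝ), 1, 0] ^ 2 * s2 ![(0 : ℝ), 0, 1] = 4 := by
    simp [s2, Fin.sum_univ_three]; norm_num
  rw [h1, h2, hs1, hs2]
  intro h
  apply hκ
  linarith [show 3 / 4 * κ * 4 / 4 = κ * 1 / 1 from h]

end QuarticSymbol

/-! ## §5c The scalar mechanism (generation 3): where the two terms of `quarticDefectScalar` come from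

[analysis → kernel arithmetic; formal Taylor level, scalar block means only]  With coarse momentum `P = Lp`,
the one-step effective form of scalar block means is `S_c = K(P/L)/|q̂(P/L)|² + O(P⁶)` — the cover momenta
`p + 2πl/L`, `l ≠ 0`, contribute `R = O(P²)` to `1/S_c = |q̂|²/K + R` whose leading term is `O(P^{−2})`, hence
only `O(P⁶)` to `S_c`.  Per direction `L² sin²(x/2)/sin²(Lx/2) = (1 − x²/12)/(1 − L²x²/12) + O(x⁴)` at
`x = P_μ/L` gives `1/|q̂(P/L)|² = 1 + (κ_L/2)|P|² + O(P⁴)` (`(L² − 1)/(12L²) = κ_L/2`), and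
`4 sin²(x/2) = x² − x⁴/12 + O(x⁶)` gives `L²K(P/L) = |P|² − ΣP_μ⁴/(12L²) + O(P⁶)`, `K_c(P) = |P|² − ΣP_μ⁴/12 + O(P⁶)`.
So `M = L²S_c − K_c = (κ_L/2)|P|⁴ + (1/12 − 1/(12L²))ΣP_μ⁴ + O(P⁶) = (κ_L/2)(|P|⁴ + ΣP_μ⁴) + O(P⁶)`: the
scalar closed form found numerically (§5b) is DERIVED at this level; the isotropic term is the block-average
symbol, the anisotropic term is the two-spacing difference of the lattice Laplacian's quartic Taylor term — a
local operator `(1/12)(1 − L⁻²)Σ_μ∂_μ⁴`, yet NOT divisible by `Δ` in the ring of local operators for `d ≥ 2`, so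
`n = M/Δ²` is a genuine degree-0 multiplier.  The 1-form closed form of §5b remains conjectured. -/

section ScalarMechanism

/-- `κ_L/2 = 1/12 − 1/(12L²)`: HALF the block second moment equals the DIFFERENCE of the quartic Taylor
coefficients of the lattice Laplacian symbol `4 sin²(x/2) = x² − x⁴/12 + O(x⁶)` at the two spacings (coarse
units: `L²·4sin²(P/(2L)) = P² − P⁴/(12L²) + …` versus `4 sin²(P/2) = P² − P⁴/12 + …`).  [analysis →
kernel arithmetic] This is the mechanism of the anisotropic term `(κ_L/2)Σ_μ ξ_μ⁴` of `quarticDefectScalar`: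
it is the two-spacing Laplacian difference `(1/12)(1 − L⁻²)Σ_μ ∂_μ⁴`, a LOCAL lattice artefact, while the
isotropic `(κ_L/2)|ξ|⁴` comes from the block-average symbol `1/|q̂(P/L)|² = 1 + (κ_L/2)|P|² + O(P⁴)`; cover
momenta `l ≠ 0` enter the effective form only at `O(P⁶)` — so the scalar closed form is DERIVED at the formal
Taylor level (the 1-form closed form remains conjectured). [folklore] -/
theorem kappa_half_eq {L : ℕ} (hL : 0 < L) :
    kappa L / 2 = 1 / 12 - 1 / (12 * (L : ℝ) ^ 2) := by
  have hL' : (0 : ℝ) < L := by exact_mod_cast hL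
  unfold kappa
  field_simp
  ring

/-- The scalar quartic bookkeeping: if (formal Taylor data) the block-average factor is `1 + (κ/2)·S₂`, the
rescaled fine Laplacian symbol is `S₂ − S₄/(12L²)` and the coarse one is `S₂ − S₄/12`, then the quartic part of
`L²S_c − K_c = (S₂ − S₄/(12L²))(1 + (κ/2)S₂) − (S₂ − S₄/12)` is `quarticDefectScalar`-shaped,
`(κ/2)S₂² + (1/12 − 1/(12L²))S₄`, the rest being the sextic cross term. [folklore] -/
theorem scalar_quartic_bookkeeping (κ L S₂ S₄ : ℝ) :
    (S₂ - S₄ / (12 * L ^ 2)) * (1 + κ / 2 * S₂) - (S₂ - S₄ / 12)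
      = (κ / 2 * S₂ ^ 2 + (1 / 12 - 1 / (12 * L ^ 2)) * S₄) - κ / 2 * S₂ * (S₄ / (12 * L ^ 2)) := by
  ring

/-- Hence, with `κ = κ_L`, the quartic part IS `quarticDefectScalar κ_L ξ = (κ_L/2)(|ξ|⁴ + Σξ_μ⁴)`. [folklore] -/
theorem quarticDefectScalar_eq_bookkeeping {L : ℕ} (hL : 0 < L) {d : ℕ} (ξ : Fin d → ℝ) :
    quarticDefectScalar (kappa L) ξ
      = kappa L / 2 * s2 ξ ^ 2 + (1 / 12 - 1 / (12 * (L : ℝ) ^ 2)) * s4 ξ := by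
  rw [← kappa_half_eq hL]
  unfold quarticDefectScalar
  ring

end ScalarMechanism

/-! ## §6 Examples -/

/-- L = 2: κ₂ = 1/8 and ν₂ = (1/8)/(1 − 1/2) = 1/4. [folklore] -/
example : kappa 2 = 1 / 8 ∧ nu 2 = 1 / 4 := by
  refine ⟨by rw [kappa]; norm_num, ?_⟩
  rw [nu, kappa]; norm_num

/-- Instantiating §4 (`oneStepCorrectionRate_of_noSheet`) on trivial sized data — x = g = j = 0, L = 2,
C_Π = C_Π′ = 0, C_D = 2, ν = ν_2 = 1/4, B = 1: every hypothesis is met and the conclusion is the rate statement with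
ρ = (1 + 0 + 2 + 0)·(1/4)·1, θ = 1/2 (the theorem is USED, not re-proved). [folklore] -/
example : OneStepCorrectionRate (Set.univ : Set Unit)
    (fun k _ => max ((0 : ℝ) / (2 : ℝ)⁻¹ ^ k) (0 / ((2 : ℝ)⁻¹ ^ k) ^ 2)) ((1 + 0 + 2 + 0) * (1 / 4) * 1) 2⁻¹ :=
  oneStepCorrectionRate_of_noSheet (fun _ _ => 0) (fun _ _ => 0) (fun _ _ => 0) _
    (by norm_num) le_rfl (by norm_num) le_rfl (by norm_num) (by norm_num)
    (fun k V _ => by simp) (fun k V _ => by simp) (fun k V _ => by positivity) (fun k V _ => rfl)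

/-- Instantiating §4b (`oneStepCorrectionRate_of_lrr`) likewise — z = t = osc = 0, L = 2, all constants 1:
the conclusion is the rate statement with θ′ = (1 + log 2)/2. [folklore] -/
example : OneStepCorrectionRate (Set.univ : Set Unit) (fun _ _ => (0 : ℝ))
    ((1 + 1) * (1 + 1) * 1 * 1 + 1 * 1) ((1 + Real.log 2) / 2) :=
  oneStepCorrectionRate_of_lrr (fun _ _ => 0) (fun _ _ => 0) _
    (by norm_num) zero_le_one zero_le_one zero_le_one zero_le_one zero_le_one zero_le_one
    (fun k V _ => by
      have : 0 ≤ Real.log 2 := Real.log_nonneg (by norm_num)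
      positivity)
    (fun k V _ => by positivity) (fun k V _ => by simp)

/-- The wall predicate `LRRSized` is not vacuous as a shape: zero data satisfy it (L = 2, all constants 1).
[folklore] -/
example : LRRSized (Set.univ : Set Unit) (fun _ _ => (0 : ℝ)) (fun _ _ => 0) (fun _ _ => 0) 2 1 1 1 1 1 1 := by
  refine ⟨fun k V _ => ?_, fun k V _ => by positivity, fun k V _ => by simp⟩
  have : 0 ≤ Real.log 2 := Real.log_nonneg (by norm_num)
  positivity

/-- L = 2 (κ₂ = 1/8): the conjectured scalar symbol takes the gen-1 toy values 1/8 = 0.125 on the axis and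
3/32 = 0.09375 (normalised) on the diagonal. [folklore] -/
example : quarticDefectScalar (kappa 2) ![1, 0] = 1 / 8 ∧
    quarticDefectScalar (kappa 2) ![1, 1] / 4 = 3 / 32 := by
  simp only [quarticDefectScalar, s2, s4, Fin.sum_univ_two, Matrix.cons_val_zero, Matrix.cons_val_one, kappa]
  norm_num

/-- Example (sharp rate): zero data gives `LocalRate`-grade `OneStepCorrectionRate` at rate `L^{−1/2}` with the
constant `2e^{−1/2}·0 + 0`. [folklore] -/
example : OneStepCorrectionRate (Set.univ : Set Unit) (fun _ _ => (0 : ℝ))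
    ((1 + 0) * (1 + 0) * 0 * 0 * (Real.exp (-(1 / 2 : ℝ)) / (1 - 1 / 2)) + 0 * 0) ((2 : ℝ) ^ (-(1 / 2 : ℝ))) :=
  oneStepCorrectionRate_of_lrr_rpow (L := 2) (fun _ _ => 0) (fun _ _ => 0) (fun _ _ => 0)
    (by norm_num) (by norm_num) le_rfl le_rfl le_rfl le_rfl le_rfl le_rfl
    (fun k _ _ => by simp) (fun k _ _ => by simp) (fun k _ _ => by simp)

/-- Example (mechanism): `κ₂/2 = 1/16 = 1/12 − 1/48`. [folklore] -/
example : kappa 2 / 2 = 1 / 12 - 1 / (12 * (2 : ℝ) ^ 2) := kappa_half_eq (by norm_num)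

end Literature.MathematicalPhysics.QuantumFieldTheory.Balaban1983to89.T4OneStepFactorisation
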